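import Literature.Computability.Complexity.NumProgramsDivision
import HarnessLib

/-!
# Numeric register programs, VII: the remainder tree (multipoint evaluation)

Literature / complexity toolkit, continuing `NumProgramsDiv.lean`.  Going *down* the subproduct
tree of `NumProgramsProductTree.lean` with the division `divP` of `NumProgramsDiv.lean`
evaluates a polynomial `g` (of degree at most `P = 2^K`) at all `P` points at once (von zur
Gathen–Gerhard 2013, §10.1, Algorithm 10.5 / Theorem 10.6; used by Harvey 2021, Prop. 2.5 for
the points of an arithmetic progression):

* the mathematics: `remBlock N g vals j i` (the coefficient list of length `2^j` of
  `g mod ∏_{t<2^j} (X - v_{i 2^j + t})`), **`modByMonic_modByMonic_of_dvd`**, the root step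
  `remBlock K 0 = trunc_P (g - g_P · root)`, the descent `remBlock j (2i), remBlock j (2i+1)`
  from `remBlock (j+1) i` by `divP`, and the leaves `remBlock 0 i = [g(v_i)]`;
* the program `remtreeP` with **`remtreeP_spec`** / **`remtreeP_extOK`**.

## References

* J. von zur Gathen, J. Gerhard, *Modern Computer Algebra*, 3rd ed., CUP 2013, §10.1
  (Algorithm 10.5, Theorem 10.6) [GathenGerhard2013].
* D. Harvey, *An exponent one-fifth algorithm for deterministic integer factorisation*, Math.
  Comp. 90 (2021), §2.3 [Harvey2021].
-/

namespace Literature.Computability.Complexity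

open _root_.Computability Polynomial

/-! ### Remainders down the tree -/

section RemData

open NCom

variable {R : Type*} [CommRing R]

/-- Reducing modulo a monic factor of the modulus. [folklore] -/
theorem modByMonic_modByMonic_of_dvd [Nontrivial R] {p q m : R[X]} (hq : q.Monic) (hm : m.Monic) (hqm : q ∣ m) :
    (p %ₘ m) %ₘ q = p %ₘ q := by
  obtain ⟨r, rfl⟩ := hqm
  have h1 := modByMonic_add_div p (q * r)
  have h2 := modByMonic_add_div (p %ₘ (q * r)) q
  -- `p = q (r s + s') + t'` with `deg t' < deg q`
  have key : (p %ₘ (q * r)) %ₘ q + q * (r * (p /ₘ (q * r)) + (p %ₘ (q * r)) /ₘ q) = p := by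
    rw [mul_add, ← mul_assoc, ← add_assoc, add_comm ((p %ₘ (q * r)) %ₘ q), add_assoc, h2]; rw [add_comm]; exact h1
  exact ((div_modByMonic_unique _ _ hq ⟨key, degree_modByMonic_lt _ hq⟩).2).symm

variable (N : ℕ)

/-- The remainder block of level `j`, index `i`: the coefficient list of length `2^j` of
`g mod ∏_{t<2^j} (X - v_{i 2^j + t})`. [von zur Gathen–Gerhard 2013, §10.1] [folklore] -/
noncomputable def remBlock (g : (ZMod N)[X]) (vals : List ℕ) (j i : ℕ) : List ℕ :=
  coeffList N (2 ^ j) (g %ₘ nodePoly N ((vals.drop (i * 2 ^ j)).take (2 ^ j)))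

/-- The run of remainder blocks `a, …, a + c - 1` of level `j`. [folklore] -/
noncomputable def remsFrom (g : (ZMod N)[X]) (vals : List ℕ) (j a c : ℕ) : List ℕ :=
  ((List.range' a c).map (remBlock N g vals j)).flatten

variable {N}

/-- Length of a remainder block. [folklore] -/
@[simp] theorem length_remBlock (g : (ZMod N)[X]) (vals : List ℕ) (j i : ℕ) : (remBlock N g vals j i).length = 2 ^ j :=
  length_coeffList _ _ _

/-- Entries of a remainder block are reduced. [folklore] -/
theorem lt_of_mem_remBlock (hN : 1 < N) {g : (ZMod N)[X]} {vals : List ℕ} {j i x : ℕ} (hx : x ∈ remBlock N g vals j i) : x < N :=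
  lt_of_mem_coeffList hN hx

/-- No blocks. [folklore] -/
@[simp] theorem remsFrom_zero (g : (ZMod N)[X]) (vals : List ℕ) (j a : ℕ) : remsFrom N g vals j a 0 = [] := rfl

/-- The first block in front. [folklore] -/
theorem remsFrom_succ (g : (ZMod N)[X]) (vals : List ℕ) (j a c : ℕ) :
    remsFrom N g vals j a (c + 1) = remBlock N g vals j a ++ remsFrom N g vals j (a + 1) c := by
  simp [remsFrom, List.range'_succ]

/-- One more block at the end. [folklore] -/
theorem remsFrom_concat (g : (ZMod N)[X]) (vals : List ℕ) (j a c : ℕ) :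
    remsFrom N g vals j a (c + 1) = remsFrom N g vals j a c ++ remBlock N g vals j (a + c) := by
  simp [remsFrom, List.range'_concat]

/-- Length of a run of remainder blocks. [folklore] -/
theorem length_remsFrom (g : (ZMod N)[X]) (vals : List ℕ) (j a c : ℕ) : (remsFrom N g vals j a c).length = c * 2 ^ j := by
  induction c generalizing a with
  | zero => simp
  | succ c ih => rw [remsFrom_succ, List.length_append, length_remBlock, ih, Nat.succ_mul]; omega

/-- Entries of a run of remainder blocks are reduced. [folklore] -/
theorem lt_of_mem_remsFrom (hN : 1 < N) {g : (ZMod N)[X]} {vals : List ℕ} {j a c x : ℕ} (hx : x ∈ remsFrom N g vals j a c) : x < N := by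
  simp only [remsFrom, List.mem_flatten, List.mem_map, List.mem_range'] at hx
  obtain ⟨l, ⟨i, -, rfl⟩, hx⟩ := hx
  exact lt_of_mem_remBlock hN hx

/-- Reading the first block off a run. [folklore] -/
theorem take_remsFrom_succ (g : (ZMod N)[X]) (vals : List ℕ) (j a c : ℕ) :
    (remsFrom N g vals j a (c + 1)).take (2 ^ j) = remBlock N g vals j a := by
  rw [remsFrom_succ, List.take_append_of_le_length (by simp), List.take_of_length_le (by simp)]

/-- Dropping the first block off a run. [folklore] -/
theorem drop_remsFrom_succ (g : (ZMod N)[X]) (vals : List ℕ) (j a c : ℕ) :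
    (remsFrom N g vals j a (c + 1)).drop (2 ^ j) = remsFrom N g vals j (a + 1) c := by
  rw [remsFrom_succ, List.drop_append_of_le_length (by simp), List.drop_of_length_le (by simp), List.nil_append]

/-- The node polynomial of a sub-run divides the node polynomial of the run. [folklore] -/
theorem nodePoly_child_dvd (vals : List ℕ) (j i : ℕ) (b : Bool) :
    nodePoly N ((vals.drop ((2 * i + b.toNat) * 2 ^ j)).take (2 ^ j)) ∣ nodePoly N ((vals.drop (i * 2 ^ (j + 1))).take (2 ^ (j + 1))) := by
  have e : (vals.drop (i * 2 ^ (j + 1))).take (2 ^ (j + 1)) =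
      (vals.drop (2 * i * 2 ^ j)).take (2 ^ j) ++ (vals.drop ((2 * i + 1) * 2 ^ j)).take (2 ^ j) := by
    rw [show i * 2 ^ (j + 1) = 2 * i * 2 ^ j by ring, show (2 ^ (j + 1) : ℕ) = 2 ^ j + 2 ^ j by ring, List.take_add, List.drop_drop,
      show 2 * i * 2 ^ j + 2 ^ j = (2 * i + 1) * 2 ^ j by ring]
  rw [e, nodePoly_append]
  cases b
  · simp only [Bool.toNat_false, Nat.add_zero]; exact Dvd.intro _ rfl
  · simp only [Bool.toNat_true]; exact Dvd.intro_left _ rfl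

/-- **The descent**: dividing the remainder block of level `j + 1` by a child's tree block
gives the child's remainder block (`1 < N`). [von zur Gathen–Gerhard 2013, Theorem 10.6] [folklore] -/
theorem remBlock_child (hN : 1 < N) (g : (ZMod N)[X]) (vals : List ℕ) (j i : ℕ) (b : Bool) :
    coeffList N (2 ^ j) (listPoly N (remBlock N g vals (j + 1) i) %ₘ listPoly N (treeBlock N vals j (2 * i + b.toNat))) =
      remBlock N g vals j (2 * i + b.toNat) := by
  haveI : Fact (1 < N) := ⟨hN⟩
  have hdeg : ∀ m k, (nodePoly N ((vals.drop m).take k)).degree ≤ k := by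
    intro m k
    rw [Polynomial.degree_eq_natDegree (monic_nodePoly N _).ne_zero, natDegree_nodePoly N hN, Nat.cast_le, List.length_take]
    omega
  unfold remBlock
  rw [listPoly_treeBlock hN, listPoly_coeffList hN]
  · congr 1
    exact modByMonic_modByMonic_of_dvd (monic_nodePoly N _) (monic_nodePoly N _) (nodePoly_child_dvd vals j i b)
  · refine (degree_modByMonic_lt _ (monic_nodePoly N _)).trans_le ?_
    calc (nodePoly N ((vals.drop (i * 2 ^ (j + 1))).take (2 ^ (j + 1)))).degree ≤ (2 ^ (j + 1) : ℕ) := hdeg _ _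
      _ = _ := by norm_cast

/-- **The leaves**: the remainder block of level `0` is the value (`1 < N`, index in range).
[folklore] -/
theorem remBlock_zero (g : (ZMod N)[X]) {vals : List ℕ} {i : ℕ} (hi : i < vals.length) :
    remBlock N g vals 0 i = [(g.eval (vals[i] : ZMod N)).val] := by
  unfold remBlock
  rw [pow_zero, Nat.mul_one, List.take_one_drop_eq_of_lt_length hi]
  simp only [nodePoly_cons, nodePoly_nil, mul_one, modByMonic_X_sub_C_eq_C_eval]
  simp [coeffList]

/-- **The root step**: for `deg g ≤ P = 2^K` with top coefficient `g_P`,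
`g mod root = trunc_P (g - g_P · root)`, i.e. on lists `linc N 1 g_P GIN ROOT P` (`GIN` of
length `P + 1` coding `g`, `ROOT = treeBlock K 0`; `|vals| = P`). [folklore] -/
theorem remBlock_root (hN : 1 < N) {K : ℕ} {GIN vals : List ℕ} (hG : GIN.length = 2 ^ K + 1) (hvals : vals.length = 2 ^ K) :
    linc N 1 (GIN.getD (2 ^ K) 0) GIN (treeBlock N vals K 0) (2 ^ K) = remBlock N (listPoly N GIN) vals K 0 := by
  haveI : Fact (1 < N) := ⟨hN⟩
  set g := listPoly N GIN with hg
  set root := nodePoly N ((vals.drop (0 * 2 ^ K)).take (2 ^ K)) with hroot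
  have hmon : root.Monic := monic_nodePoly N _
  have hrdeg : root.natDegree = 2 ^ K := by rw [hroot, natDegree_nodePoly N hN, List.length_take, List.length_drop]; omega
  have hgdeg : g.natDegree ≤ 2 ^ K := by
    have := natDegree_listPoly_lt (N := N) (l := GIN) (by omega); rw [← hg, hG] at this; omega
  -- `g = g_P root + (g - g_P root)` with the second of degree `< P`
  set c : ZMod N := ((GIN.getD (2 ^ K) 0 : ℕ) : ZMod N) with hc
  have hgc : g.coeff (2 ^ K) = c := by rw [hg, coeff_listPoly]
  have hlow : (g - C c * root).degree < root.degree := by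
    rw [Polynomial.degree_eq_natDegree hmon.ne_zero, hrdeg, Polynomial.degree_lt_iff_coeff_zero]
    intro m hm
    rw [coeff_sub, coeff_C_mul]
    rcases (show 2 ^ K = m ∨ 2 ^ K < m by omega) with rfl | hlt
    · rw [hgc, show root.coeff (2 ^ K) = 1 from by rw [← hrdeg]; exact hmon, mul_one, sub_self]
    · rw [coeff_eq_zero_of_natDegree_lt (by omega), coeff_eq_zero_of_natDegree_lt (by omega), mul_zero, sub_zero]
  have hrem : g %ₘ root = g - C c * root :=
    (div_modByMonic_unique (C c) (g - C c * root) hmon ⟨by ring, hlow⟩).2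
  have hlowN : (g - C c * root).natDegree < 2 ^ K := by
    have h0 : g - C c * root = 0 ∨ (g - C c * root).degree < (2 ^ K : ℕ) := by
      right; rw [Polynomial.degree_eq_natDegree hmon.ne_zero, hrdeg] at hlow; exact_mod_cast hlow
    rcases eq_or_ne (g - C c * root) 0 with h | h
    · rw [h, natDegree_zero]; exact Nat.one_le_two_pow
    · exact (Polynomial.natDegree_lt_iff_degree_lt h).2 (by rw [Polynomial.degree_eq_natDegree hmon.ne_zero, hrdeg] at hlow; exact_mod_cast hlow)
  -- the list side
  have hRl : (treeBlock N vals K 0).length = 2 ^ K + 1 := length_treeBlock _ _ _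
  have hRN : ∀ x ∈ (treeBlock N vals K 0).take (2 ^ K), x < N := fun x hx => lt_of_mem_treeBlock hN (List.mem_of_mem_take hx)
  have hRt : ((treeBlock N vals K 0).take (2 ^ K)).length = 2 ^ K := by rw [List.length_take, hRl]; omega
  have e1 : listPoly N (linc N 1 (GIN.getD (2 ^ K) 0) GIN (treeBlock N vals K 0) (2 ^ K)) = g - C c * root := by
    have key := listPoly_linc' (N := N) (x := GIN.getD (2 ^ K) 0) (us := GIN) hRN
    rw [hRt] at key
    rw [linc_take, key, listPoly_take, listPoly_treeBlock hN, ← hroot, ← hg, ← C_eq_natCast, ← hc, ptrunc_sub,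
      show ptrunc (2 ^ K) (C c * ptrunc (2 ^ K) root) = ptrunc (2 ^ K) (C c * root) from ptrunc_mul_right _ _ _, ← ptrunc_sub]
    exact ptrunc_eq_self fun i hi => coeff_eq_zero_of_natDegree_lt (by omega)
  unfold remBlock
  rw [← hroot, hrem]
  refine listPoly_injective (N := N) (by rw [length_linc, length_coeffList]) (fun x hx => lt_of_mem_linc (by omega) hx)
    (fun x hx => lt_of_mem_coeffList hN hx) ?_
  rw [e1, listPoly_coeffList hN]
  exact (Polynomial.degree_le_natDegree).trans_lt (by exact_mod_cast hlowN)

/-- A full tree block ends in `1` (`1 < N`, the run lies inside `vals`). [folklore] -/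
theorem getLast_treeBlock (hN : 1 < N) {vals : List ℕ} {j i : ℕ} (hi : (i + 1) * 2 ^ j ≤ vals.length) :
    (treeBlock N vals j i).getLast? = some 1 := by
  haveI : Fact (1 < N) := ⟨hN⟩
  have hmon := monic_nodePoly N ((vals.drop (i * 2 ^ j)).take (2 ^ j))
  have hdeg : (nodePoly N ((vals.drop (i * 2 ^ j)).take (2 ^ j))).natDegree = 2 ^ j := by
    rw [natDegree_nodePoly N hN, List.length_take, List.length_drop, Nat.min_eq_left]
    rw [Nat.succ_mul] at hi; omega
  have hc : (nodePoly N ((vals.drop (i * 2 ^ j)).take (2 ^ j))).coeff (2 ^ j) = 1 := by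
    rw [show (nodePoly N ((vals.drop (i * 2 ^ j)).take (2 ^ j))).coeff (2 ^ j) =
      (nodePoly N ((vals.drop (i * 2 ^ j)).take (2 ^ j))).coeff (nodePoly N ((vals.drop (i * 2 ^ j)).take (2 ^ j))).natDegree by rw [hdeg]]
    exact hmon.coeff_natDegree
  rw [List.getLast?_eq_getElem?, length_treeBlock, Nat.add_sub_cancel]
  unfold treeBlock coeffList
  rw [List.getElem?_map, List.getElem?_range (by omega)]
  simp only [Option.map_some, hc, ZMod.val_one]

end RemData

/-- The cost bound of one division `divP` at degree `d` (from `divP_spec`). [folklore] -/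
def divCost (cost : ℕ → ℕ) (d : ℕ) : ℕ :=
  d.size * (200 * d + cost (4 * d) + cost (6 * d) + 101) + cost (4 * d) + cost (4 * d + 2) + 400 * d + 200

namespace NCom

variable {S V O X E : Type} [DecidableEq S] [DecidableEq V] [DecidableEq O] {𝓔 : NExt S V O X E}

/-! ### The remainder-tree program -/

/-- Scalar roles of `remtreeP`: those of `divP`, the shape `K, P`, the parent count `cnt`, the
top coefficient `top` of the input polynomial, the constant `two`, scratch. [folklore] -/
inductive RemS where
  | dv (i : DivS) | K | P | cnt | top | two | q2
  deriving DecidableEq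

/-- Queue roles of `remtreeP`: those of `divP`, the tree, the current remainders, the input
polynomial. [folklore] -/
inductive RemV where
  | rv (i : DivV) | TREE | REM | GIN
  deriving DecidableEq

/-- Accumulator roles of `remtreeP`: those of `divP` and the parent copy. [folklore] -/
inductive RemO where
  | ro (i : DivO) | accP
  deriving DecidableEq

/-- Embedding of the division's scalar roles. [folklore] -/
def RemS.dvE : DivS ↪ RemS := ⟨RemS.dv, fun _ _ h => RemS.dv.inj h⟩
/-- Embedding of the division's queue roles. [folklore] -/
def RemV.rvE : DivV ↪ RemV := ⟨RemV.rv, fun _ _ h => RemV.rv.inj h⟩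
/-- Embedding of the division's accumulator roles. [folklore] -/
def RemO.roE : DivO ↪ RemO := ⟨RemO.ro, fun _ _ h => RemO.ro.inj h⟩

/-- Unfolding the embedding. [folklore] -/
@[simp] theorem RemS.dvE_apply (i : DivS) : RemS.dvE i = .dv i := rfl
/-- Unfolding the embedding. [folklore] -/
@[simp] theorem RemV.rvE_apply (i : DivV) : RemV.rvE i = .rv i := rfl
/-- Unfolding the embedding. [folklore] -/
@[simp] theorem RemO.roE_apply (i : DivO) : RemO.roE i = .ro i := rfl

section Rem

variable (M : Multiplier 𝓔) (ρ : RemS ↪ S) (ν : RemV ↪ V) (ω : RemO ↪ O)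

local notation "ρd" => (RemS.dvE.trans ρ)
local notation "νd" => (RemV.rvE.trans ν)
local notation "ωd" => (RemO.roE.trans ω)
local notation "ρl" => (InvS.lnE.trans (DivS.ivE.trans (RemS.dvE.trans ρ)))
/-- the transfer scalar -/ local notation "𝔵" => ρ (RemS.dv (DivS.iv (InvS.pm PMulS.x)))
/-- the transfer accumulator -/ local notation "𝔞" => ω (RemO.ro (DivO.vo InvO.acc))

/-- First half of a pair step: the parent remainder to the dividend queue (and a copy to
`accP`), the first child block to the divisor queue. [folklore] -/
def pairS1 : NCom S V O E :=
  add (ρ (.dv .d2)) (ρ (.dv .d)) (ρ (.dv .d)) ;ₙ setc (ρ (.dv .d1)) 1 ;ₙ add (ρ (.dv .d1)) (ρ (.dv .d1)) (ρ (.dv .d)) ;ₙ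
  teeN (ν .REM) 𝔞 (ω .accP) 𝔵 (ρ (.dv .d2)) ;ₙ pour 𝔞 (ν (.rv .DA)) ;ₙ
  moveN (ν .TREE) 𝔞 𝔵 (ρ (.dv .d1)) ;ₙ pour 𝔞 (ν (.rv .DB))

/-- Second half of a pair step: the copy of the parent to the dividend queue, the second child
block to the divisor queue. [folklore] -/
def pairS2 : NCom S V O E :=
  pour (ω .accP) (ν (.rv .DA)) ;ₙ setc (ρ (.dv .d1)) 1 ;ₙ add (ρ (.dv .d1)) (ρ (.dv .d1)) (ρ (.dv .d)) ;ₙ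
  moveN (ν .TREE) 𝔞 𝔵 (ρ (.dv .d1)) ;ₙ pour 𝔞 (ν (.rv .DB))

/-- One pair step: the two children's remainders of one parent. [von zur Gathen–Gerhard 2013,
Algorithm 10.5] [folklore] -/
def pairR : NCom S V O E :=
  pairS1 ρ ν ω ;ₙ (divP M ρd νd ωd ;ₙ (pairS2 ρ ν ω ;ₙ divP M ρd νd ωd))

/-- One level: all pairs, the new remainders become current, `d := d / 2`, `cnt := 2 cnt`.
[folklore] -/
def levelR : NCom S V O E :=
  times (ρ .cnt) (pairR M ρ ν ω) ;ₙ
  (pour (ω (.ro .accR)) (ν .REM) ;ₙ divmod (ρ (.dv .d)) (ρ .q2) (ρ (.dv .d)) (ρ .two) ;ₙ add (ρ .cnt) (ρ .cnt) (ρ .cnt))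

/-- Initialisation and root step: constants, `REM := g mod root` by one coefficientwise
combination, `d := P / 2`, `cnt := 1`. [folklore] -/
def remInit : NCom S V O E :=
  setc (ρ .two) 2 ;ₙ setc (ρ (.dv (.iv .one))) 1 ;ₙ setc (ρ (.dv (.iv (.ln .cu)))) 1 ;ₙ mov (ρ (.dv (.iv (.ln .cv)))) (ρ .top) ;ₙ
  mov (ρ (.dv (.iv (.ln .n)))) (ρ (.dv (.iv (.pm .n)))) ;ₙ mov (ρ (.dv (.iv (.ln .cnt)))) (ρ .P) ;ₙ
  (linP ρl (ν .GIN) (ν .TREE) (ω (.ro .accR)) ;ₙ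
  (pop (ν .TREE) 𝔵 ;ₙ clearV (ν .GIN) ;ₙ pour (ω (.ro .accR)) (ν .REM) ;ₙ
   divmod (ρ (.dv .d)) (ρ .q2) (ρ .P) (ρ .two) ;ₙ setc (ρ .cnt) 1))

/-- **The remainder tree**: from `TREE = treeAcc N vals K (K+1)` (all levels of the subproduct
tree, root first) and `GIN` coding `g` (`|GIN| = P + 1`, `top = g_P`), compute
`REM = [g(v_0), …, g(v_{P-1})]`. [von zur Gathen–Gerhard 2013, Algorithm 10.5] [folklore] -/
def remtreeP : NCom S V O E := remInit ρ ν ω ;ₙ times (ρ .K) (levelR M ρ ν ω)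

omit [DecidableEq S] [DecidableEq V] [DecidableEq O] in
/-- The pair stages have no extension calls. [folklore] -/
theorem pairS_noExt : (pairS1 ρ ν ω : NCom S V O E).noExt ∧ (pairS2 ρ ν ω : NCom S V O E).noExt := by
  simp [pairS1, pairS2, noExt, teeN_noExt, moveN_noExt]

/-- The standing part of the state during the remainder tree: the modulus, the constant `one`,
empty work queues of the division, empty parent copy. [folklore] -/
structure RemInv (N : ℕ) (σ : NState S V O) : Prop where
  hn : σ.sc (ρ (.dv (.iv (.pm .n)))) = N
  hT : σ.vi (ν (.rv .T)) = []
  hT2 : σ.vi (ν (.rv .T2)) = []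
  hQ : σ.vi (ν (.rv .Q)) = []
  hRB : σ.vi (ν (.rv (.vv .RB))) = []
  hG : σ.vi (ν (.rv (.vv .G))) = []
  hpA : σ.vi (ν (.rv (.vv (.pv .A)))) = []
  hpB : σ.vi (ν (.rv (.vv (.pv .B)))) = []
  hpF : σ.vi (ν (.rv (.vv (.pv .F)))) = []
  hpG : σ.vi (ν (.rv (.vv (.pv .G)))) = []
  hpH : σ.vi (ν (.rv (.vv (.pv .H)))) = []
  hpC : σ.vi (ν (.rv (.vv (.pv .C)))) = []
  hacc : σ.vo (ω (.ro (.vo .acc))) = []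
  hacc2 : σ.vo (ω (.ro (.vo .acc2))) = []
  haccL : σ.vo (ω (.ro (.vo .accL))) = []
  haccP : σ.vo (ω .accP) = []
  hDA : σ.vi (ν (.rv .DA)) = []
  hDB : σ.vi (ν (.rv .DB)) = []

set_option maxHeartbeats 10000000 in
set_option linter.unusedSimpArgs false in -- one uniform simp set drives the symbolic execution of every stage
/-- **One pair step** (von zur Gathen–Gerhard 2013, Algorithm 10.5): the parent remainder
`remBlock (j+1) i` at the front of `REM` and the two child blocks `treeBlock j (2i)`,
`treeBlock j (2i+1)` at the front of `TREE` are consumed, `accR` gains the children's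
remainders `remBlock j (2i) ++ remBlock j (2i+1)`. [folklore] -/
theorem pairR_spec {N : ℕ} (hN : 1 < N) (hodd : Odd N) (g : (ZMod N)[X]) (vals : List ℕ) (j i : ℕ) (restR restT : List ℕ)
    (σ : NState S V O) (hI : RemInv ρ ν ω N σ) (hvals : (2 * i + 2) * 2 ^ j ≤ vals.length)
    (hREM : σ.vi (ν .REM) = remBlock N g vals (j + 1) i ++ restR)
    (hTREE : σ.vi (ν .TREE) = treeBlock N vals j (2 * i) ++ (treeBlock N vals j (2 * i + 1) ++ restT))
    (hd : σ.sc (ρ (.dv .d)) = 2 ^ j) :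
    let τ := (pairR M ρ ν ω : NCom S V O E).eval 𝓔 σ
    RemInv ρ ν ω N τ ∧
      τ.vo (ω (.ro .accR)) = σ.vo (ω (.ro .accR)) ++ (remBlock N g vals j (2 * i) ++ remBlock N g vals j (2 * i + 1)) ∧
      τ.vi (ν .REM) = restR ∧ τ.vi (ν .TREE) = restT ∧ τ.sc (ρ (.dv .d)) = 2 ^ j ∧
      (∀ w, (∀ i, w ≠ ν i) → τ.vi w = σ.vi w) ∧ (∀ p, (∀ i, p ≠ ω i) → τ.vo p = σ.vo p) ∧ (∀ r, (∀ i, r ≠ ρ i) → τ.sc r = σ.sc r) ∧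
      (∀ r : RemS, (∀ i, r ≠ .dv i) → τ.sc (ρ r) = σ.sc (ρ r)) ∧ τ.vi (ν .GIN) = σ.vi (ν .GIN) ∧
      τ.peak ≤ max σ.peak (max (3 * N) (8 * 2 ^ j + 2)) ∧
      τ.steps ≤ σ.steps + 2 * divCost M.cost (2 ^ j) + 30 * 2 ^ j + 30 ∧
      (pairR M ρ ν ω : NCom S V O E).extOK 𝓔 σ := by
  intro τ
  obtain ⟨hn, hT, hT2, hQ, hRB, hG, hpA, hpB, hpF, hpG, hpH, hpC, hacc, hacc2, haccL, haccP, hDA, hDB⟩ := hI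
  have hoP : ω (.ro (.vo .acc)) ≠ ω .accP := by simp
  have hpow : 1 ≤ 2 ^ j := Nat.one_le_two_pow
  have hdd : 2 ^ j + 2 ^ j = 2 ^ (j + 1) := by rw [pow_succ]; ring
  have hd1l : (treeBlock N vals j (2 * i)).length = 2 ^ j + 1 := length_treeBlock _ _ _
  have hd1c : 1 + 2 ^ j = 2 ^ j + 1 := Nat.add_comm _ _
  have htakeR : (remBlock N g vals (j + 1) i ++ restR).take (2 ^ (j + 1)) = remBlock N g vals (j + 1) i := by
    rw [List.take_append_of_le_length (by simp), List.take_of_length_le (by simp)]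
  have hdropR : (remBlock N g vals (j + 1) i ++ restR).drop (2 ^ (j + 1)) = restR := by
    rw [List.drop_append_of_le_length (by simp), List.drop_of_length_le (by simp), List.nil_append]
  have htakeT1 : (treeBlock N vals j (2 * i) ++ (treeBlock N vals j (2 * i + 1) ++ restT)).take (2 ^ j + 1) = treeBlock N vals j (2 * i) := by
    rw [List.take_append_of_le_length (by simp), List.take_of_length_le (by simp)]
  have hdropT1 : (treeBlock N vals j (2 * i) ++ (treeBlock N vals j (2 * i + 1) ++ restT)).drop (2 ^ j + 1) = treeBlock N vals j (2 * i + 1) ++ restT := by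
    rw [List.drop_append_of_le_length (by simp), List.drop_of_length_le (by simp), List.nil_append]
  have htakeT2 : (treeBlock N vals j (2 * i + 1) ++ restT).take (2 ^ j + 1) = treeBlock N vals j (2 * i + 1) := by
    rw [List.take_append_of_le_length (by simp), List.take_of_length_le (by simp)]
  have hdropT2 : (treeBlock N vals j (2 * i + 1) ++ restT).drop (2 ^ j + 1) = restT := by
    rw [List.drop_append_of_le_length (by simp), List.drop_of_length_le (by simp), List.nil_append]
  have hAl : (remBlock N g vals (j + 1) i).length = 2 * 2 ^ j := by rw [length_remBlock, pow_succ]; ring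
  have hAN : ∀ x ∈ remBlock N g vals (j + 1) i, x < N := fun x hx => lt_of_mem_remBlock hN hx
  have hB1N : ∀ x ∈ treeBlock N vals j (2 * i), x < N := fun x hx => lt_of_mem_treeBlock hN hx
  have hB2N : ∀ x ∈ treeBlock N vals j (2 * i + 1), x < N := fun x hx => lt_of_mem_treeBlock hN hx
  have hlast1 : (treeBlock N vals j (2 * i)).getLast? = some 1 := getLast_treeBlock hN (by nlinarith)
  have hlast2 : (treeBlock N vals j (2 * i + 1)).getLast? = some 1 := getLast_treeBlock hN (by nlinarith)
  have hch1 := remBlock_child hN g vals j i false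
  have hch2 := remBlock_child hN g vals j i true
  simp only [Bool.toNat_false, Nat.add_zero, Bool.toNat_true] at hch1 hch2
  -- the stage states, made opaque
  set X1 := (pairS1 ρ ν ω : NCom S V O E).eval 𝓔 σ with hX1
  set Y1 := (divP M ρd νd ωd : NCom S V O E).eval 𝓔 X1 with hY1
  set X2 := (pairS2 ρ ν ω : NCom S V O E).eval 𝓔 Y1 with hX2
  have hτ : τ = (divP M ρd νd ωd : NCom S V O E).eval 𝓔 X2 := rfl
  clear_value X1 Y1 X2 τ
  -- stage 1
  have nX1 := hX1
  simp only [hREM, hTREE, hd, hn, hT, hT2, hQ, hRB, hG, hpA, hpB, hpF, hpG, hpH, hpC, hacc, hacc2, haccL, haccP, hDA, hDB, htakeR, hdropR, htakeT1, hdropT1, htakeT2, hdropT2, hdd, hd1l, hd1c, pairS1, pairS2, eval_seq, eval,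
      NState.sc_bump, NState.sc_setSc, NState.sc_setVi, NState.sc_setVo, NState.vi_bump,
      NState.vi_setSc, NState.vi_setVi, NState.vi_setVo, NState.vo_bump, NState.vo_setSc, NState.vo_setVi, NState.vo_setVo,
      NState.steps_bump, NState.steps_setSc, NState.steps_setVi, NState.steps_setVo, NState.peak_bump, NState.peak_setSc, NState.peak_setVi,
      NState.peak_setVo, Function.update_apply, EmbeddingLike.apply_eq_iff_eq, reduceCtorEq, RemV.rv.injEq, RemS.dv.injEq, RemO.ro.injEq,
      DivV.vv.injEq, DivS.iv.injEq, DivO.vo.injEq, InvV.pv.injEq, InvS.pm.injEq, InvS.ln.injEq,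
      ite_true, ite_false, not_false_eq_true, implies_true, Nat.max_zero, Nat.zero_max, Nat.le_add_right,
      List.take_length, List.drop_length, List.nil_append, List.append_nil, le_refl, List.take_append_drop, List.length_nil, List.length_append,
      List.length_take, length_remBlock, length_treeBlock, teeN_eq 𝓔 _ hoP, moveN_eq' 𝓔] at nX1
  obtain ⟨aREM, aTREE, aDA, aDB, aT, aT2, aQ, aRB, aG, apA, apB, apF, apG, apH, apC, aacc, aacc2, aaccL, aaccR, aaccP, ad, ad1, an, ad2, aGIN⟩ :
      X1.vi (ν .REM) = restR ∧
      X1.vi (ν .TREE) = treeBlock N vals j (2 * i + 1) ++ restT ∧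
      X1.vi (ν (.rv .DA)) = remBlock N g vals (j + 1) i ∧
      X1.vi (ν (.rv .DB)) = treeBlock N vals j (2 * i) ∧
      X1.vi (ν (.rv .T)) = [] ∧
      X1.vi (ν (.rv .T2)) = [] ∧
      X1.vi (ν (.rv .Q)) = [] ∧
      X1.vi (ν (.rv (.vv .RB))) = [] ∧
      X1.vi (ν (.rv (.vv .G))) = [] ∧
      X1.vi (ν (.rv (.vv (.pv .A)))) = [] ∧
      X1.vi (ν (.rv (.vv (.pv .B)))) = [] ∧
      X1.vi (ν (.rv (.vv (.pv .F)))) = [] ∧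
      X1.vi (ν (.rv (.vv (.pv .G)))) = [] ∧
      X1.vi (ν (.rv (.vv (.pv .H)))) = [] ∧
      X1.vi (ν (.rv (.vv (.pv .C)))) = [] ∧
      X1.vo (ω (.ro (.vo .acc))) = [] ∧
      X1.vo (ω (.ro (.vo .acc2))) = [] ∧
      X1.vo (ω (.ro (.vo .accL))) = [] ∧
      X1.vo (ω (.ro .accR)) = σ.vo (ω (.ro .accR)) ∧
      X1.vo (ω .accP) = remBlock N g vals (j + 1) i ∧
      X1.sc (ρ (.dv .d)) = 2 ^ j ∧
      X1.sc (ρ (.dv .d1)) = 1 + 2 ^ j ∧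
      X1.sc (ρ (.dv (.iv (.pm .n)))) = N ∧
      X1.sc (ρ (.dv .d2)) = 2 ^ j + 2 ^ j ∧
      X1.vi (ν .GIN) = σ.vi (ν .GIN) := by
    rw [nX1]; simp only [hREM, hTREE, hd, hn, hT, hT2, hQ, hRB, hG, hpA, hpB, hpF, hpG, hpH, hpC, hacc, hacc2, haccL, haccP, hDA, hDB, htakeR, hdropR, htakeT1, hdropT1, htakeT2, hdropT2, hdd, hd1l, hd1c, NState.sc_bump, NState.sc_setSc, NState.sc_setVi, NState.sc_setVo, NState.vi_bump,
      NState.vi_setSc, NState.vi_setVi, NState.vi_setVo, NState.vo_bump, NState.vo_setSc, NState.vo_setVi, NState.vo_setVo,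
      NState.steps_bump, NState.steps_setSc, NState.steps_setVi, NState.steps_setVo, NState.peak_bump, NState.peak_setSc, NState.peak_setVi,
      NState.peak_setVo, Function.update_apply, EmbeddingLike.apply_eq_iff_eq, reduceCtorEq, RemV.rv.injEq, RemS.dv.injEq, RemO.ro.injEq,
      DivV.vv.injEq, DivS.iv.injEq, DivO.vo.injEq, InvV.pv.injEq, InvS.pm.injEq, InvS.ln.injEq,
      ite_true, ite_false, not_false_eq_true, implies_true, Nat.max_zero, Nat.zero_max, Nat.le_add_right,
      List.take_length, List.drop_length, List.nil_append, List.append_nil, le_refl, List.take_append_drop, List.length_nil, List.length_append,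
      List.length_take, length_remBlock, length_treeBlock, and_self, and_true, true_and]
  have apk : X1.peak = max (max (max σ.peak (2 ^ j + 2 ^ j)) 1) (2 ^ j + 1) := by
    rw [nX1]; try simp only [hREM, hTREE, hd, hn, hT, hT2, hQ, hRB, hG, hpA, hpB, hpF, hpG, hpH, hpC, hacc, hacc2, haccL, haccP, hDA, hDB, htakeR, hdropR, htakeT1, hdropT1, htakeT2, hdropT2, hdd, hd1l, hd1c, NState.sc_bump, NState.sc_setSc, NState.sc_setVi, NState.sc_setVo, NState.vi_bump,
      NState.vi_setSc, NState.vi_setVi, NState.vi_setVo, NState.vo_bump, NState.vo_setSc, NState.vo_setVi, NState.vo_setVo,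
      NState.steps_bump, NState.steps_setSc, NState.steps_setVi, NState.steps_setVo, NState.peak_bump, NState.peak_setSc, NState.peak_setVi,
      NState.peak_setVo, Function.update_apply, EmbeddingLike.apply_eq_iff_eq, reduceCtorEq, RemV.rv.injEq, RemS.dv.injEq, RemO.ro.injEq,
      DivV.vv.injEq, DivS.iv.injEq, DivO.vo.injEq, InvV.pv.injEq, InvS.pm.injEq, InvS.ln.injEq,
      ite_true, ite_false, not_false_eq_true, implies_true, Nat.max_zero, Nat.zero_max, Nat.le_add_right,
      List.take_length, List.drop_length, List.nil_append, List.append_nil, le_refl, List.take_append_drop, List.length_nil, List.length_append,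
      List.length_take, length_remBlock, length_treeBlock]
  have ast : X1.steps ≤ σ.steps + 15 * 2 ^ j + 10 := by
    rw [nX1]; simp only [hREM, hTREE, hd, hn, hT, hT2, hQ, hRB, hG, hpA, hpB, hpF, hpG, hpH, hpC, hacc, hacc2, haccL, haccP, hDA, hDB, htakeR, hdropR, htakeT1, hdropT1, htakeT2, hdropT2, hdd, hd1l, hd1c, NState.sc_bump, NState.sc_setSc, NState.sc_setVi, NState.sc_setVo, NState.vi_bump,
      NState.vi_setSc, NState.vi_setVi, NState.vi_setVo, NState.vo_bump, NState.vo_setSc, NState.vo_setVi, NState.vo_setVo,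
      NState.steps_bump, NState.steps_setSc, NState.steps_setVi, NState.steps_setVo, NState.peak_bump, NState.peak_setSc, NState.peak_setVi,
      NState.peak_setVo, Function.update_apply, EmbeddingLike.apply_eq_iff_eq, reduceCtorEq, RemV.rv.injEq, RemS.dv.injEq, RemO.ro.injEq,
      DivV.vv.injEq, DivS.iv.injEq, DivO.vo.injEq, InvV.pv.injEq, InvS.pm.injEq, InvS.ln.injEq,
      ite_true, ite_false, not_false_eq_true, implies_true, Nat.max_zero, Nat.zero_max, Nat.le_add_right,
      List.take_length, List.drop_length, List.nil_append, List.append_nil, le_refl, List.take_append_drop, List.length_nil, List.length_append,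
      List.length_take, length_remBlock, length_treeBlock]
    clear * - hpow; omega
  have a_w : ∀ w, (∀ i, w ≠ ν i) → X1.vi w = σ.vi w := fun w hw => by rw [nX1]; simp only [hw, hREM, hTREE, hd, hn, hT, hT2, hQ, hRB, hG, hpA, hpB, hpF, hpG, hpH, hpC, hacc, hacc2, haccL, haccP, hDA, hDB, htakeR, hdropR, htakeT1, hdropT1, htakeT2, hdropT2, hdd, hd1l, hd1c, NState.sc_bump, NState.sc_setSc, NState.sc_setVi, NState.sc_setVo, NState.vi_bump,
      NState.vi_setSc, NState.vi_setVi, NState.vi_setVo, NState.vo_bump, NState.vo_setSc, NState.vo_setVi, NState.vo_setVo,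
      NState.steps_bump, NState.steps_setSc, NState.steps_setVi, NState.steps_setVo, NState.peak_bump, NState.peak_setSc, NState.peak_setVi,
      NState.peak_setVo, Function.update_apply, EmbeddingLike.apply_eq_iff_eq, reduceCtorEq, RemV.rv.injEq, RemS.dv.injEq, RemO.ro.injEq,
      DivV.vv.injEq, DivS.iv.injEq, DivO.vo.injEq, InvV.pv.injEq, InvS.pm.injEq, InvS.ln.injEq,
      ite_true, ite_false, not_false_eq_true, implies_true, Nat.max_zero, Nat.zero_max, Nat.le_add_right,
      List.take_length, List.drop_length, List.nil_append, List.append_nil, le_refl, List.take_append_drop, List.length_nil, List.length_append,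
      List.length_take, length_remBlock, length_treeBlock]
  have a_p : ∀ p, (∀ i, p ≠ ω i) → X1.vo p = σ.vo p := fun p hp => by rw [nX1]; simp only [hp, hREM, hTREE, hd, hn, hT, hT2, hQ, hRB, hG, hpA, hpB, hpF, hpG, hpH, hpC, hacc, hacc2, haccL, haccP, hDA, hDB, htakeR, hdropR, htakeT1, hdropT1, htakeT2, hdropT2, hdd, hd1l, hd1c, NState.sc_bump, NState.sc_setSc, NState.sc_setVi, NState.sc_setVo, NState.vi_bump,
      NState.vi_setSc, NState.vi_setVi, NState.vi_setVo, NState.vo_bump, NState.vo_setSc, NState.vo_setVi, NState.vo_setVo,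
      NState.steps_bump, NState.steps_setSc, NState.steps_setVi, NState.steps_setVo, NState.peak_bump, NState.peak_setSc, NState.peak_setVi,
      NState.peak_setVo, Function.update_apply, EmbeddingLike.apply_eq_iff_eq, reduceCtorEq, RemV.rv.injEq, RemS.dv.injEq, RemO.ro.injEq,
      DivV.vv.injEq, DivS.iv.injEq, DivO.vo.injEq, InvV.pv.injEq, InvS.pm.injEq, InvS.ln.injEq,
      ite_true, ite_false, not_false_eq_true, implies_true, Nat.max_zero, Nat.zero_max, Nat.le_add_right,
      List.take_length, List.drop_length, List.nil_append, List.append_nil, le_refl, List.take_append_drop, List.length_nil, List.length_append,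
      List.length_take, length_remBlock, length_treeBlock]
  have a_r : ∀ r, (∀ i, r ≠ ρ i) → X1.sc r = σ.sc r := fun r hr => by rw [nX1]; simp only [hr, hREM, hTREE, hd, hn, hT, hT2, hQ, hRB, hG, hpA, hpB, hpF, hpG, hpH, hpC, hacc, hacc2, haccL, haccP, hDA, hDB, htakeR, hdropR, htakeT1, hdropT1, htakeT2, hdropT2, hdd, hd1l, hd1c, NState.sc_bump, NState.sc_setSc, NState.sc_setVi, NState.sc_setVo, NState.vi_bump,
      NState.vi_setSc, NState.vi_setVi, NState.vi_setVo, NState.vo_bump, NState.vo_setSc, NState.vo_setVi, NState.vo_setVo,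
      NState.steps_bump, NState.steps_setSc, NState.steps_setVi, NState.steps_setVo, NState.peak_bump, NState.peak_setSc, NState.peak_setVi,
      NState.peak_setVo, Function.update_apply, EmbeddingLike.apply_eq_iff_eq, reduceCtorEq, RemV.rv.injEq, RemS.dv.injEq, RemO.ro.injEq,
      DivV.vv.injEq, DivS.iv.injEq, DivO.vo.injEq, InvV.pv.injEq, InvS.pm.injEq, InvS.ln.injEq,
      ite_true, ite_false, not_false_eq_true, implies_true, Nat.max_zero, Nat.zero_max, Nat.le_add_right,
      List.take_length, List.drop_length, List.nil_append, List.append_nil, le_refl, List.take_append_drop, List.length_nil, List.length_append,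
      List.length_take, length_remBlock, length_treeBlock]
  have a_r' : ∀ r : RemS, (∀ i, r ≠ .dv i) → X1.sc (ρ r) = σ.sc (ρ r) := fun r hr => by rw [nX1]; simp only [hr, hREM, hTREE, hd, hn, hT, hT2, hQ, hRB, hG, hpA, hpB, hpF, hpG, hpH, hpC, hacc, hacc2, haccL, haccP, hDA, hDB, htakeR, hdropR, htakeT1, hdropT1, htakeT2, hdropT2, hdd, hd1l, hd1c, NState.sc_bump, NState.sc_setSc, NState.sc_setVi, NState.sc_setVo, NState.vi_bump,
      NState.vi_setSc, NState.vi_setVi, NState.vi_setVo, NState.vo_bump, NState.vo_setSc, NState.vo_setVi, NState.vo_setVo,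
      NState.steps_bump, NState.steps_setSc, NState.steps_setVi, NState.steps_setVo, NState.peak_bump, NState.peak_setSc, NState.peak_setVi,
      NState.peak_setVo, Function.update_apply, EmbeddingLike.apply_eq_iff_eq, reduceCtorEq, RemV.rv.injEq, RemS.dv.injEq, RemO.ro.injEq,
      DivV.vv.injEq, DivS.iv.injEq, DivO.vo.injEq, InvV.pv.injEq, InvS.pm.injEq, InvS.ln.injEq,
      ite_true, ite_false, not_false_eq_true, implies_true, Nat.max_zero, Nat.zero_max, Nat.le_add_right,
      List.take_length, List.drop_length, List.nil_append, List.append_nil, le_refl, List.take_append_drop, List.length_nil, List.length_append,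
      List.length_take, length_remBlock, length_treeBlock]
  clear nX1
  -- the first division
  obtain ⟨r1, rDA, rDB, rT, rT2, rQ, rRB, rG, rpA, rpB, rpF, rpG, rpH, rpC, racc, racc2, raccL, rw', ro', rs', rd, rn, rpk, rst, rext⟩ :=
    divP_spec M (RemS.dvE.trans ρ) (RemV.rvE.trans ν) (RemO.roE.trans ω) X1 (remBlock N g vals (j + 1) i) (treeBlock N vals j (2 * i)) (2 ^ j) hpow
      (by show 1 < X1.sc (ρ (.dv (.iv (.pm .n)))); rw [an]; exact hN) (by show Odd (X1.sc (ρ (.dv (.iv (.pm .n))))); rw [an]; exact hodd)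
      aDA aDB hAl hd1l
      (by show ∀ x ∈ remBlock N g vals (j + 1) i, x < X1.sc (ρ (.dv (.iv (.pm .n)))); rw [an]; exact hAN)
      (by show ∀ x ∈ treeBlock N vals j (2 * i), x < X1.sc (ρ (.dv (.iv (.pm .n)))); rw [an]; exact hB1N)
      hlast1 ad aT aT2 aQ aRB aG apA apB apF apG apH apC aacc aacc2 aaccL
  rw [← hY1] at r1 rDA rDB rT rT2 rQ rRB rG rpA rpB rpF rpG rpH rpC racc racc2 raccL rw' ro' rs' rd rn rpk rst
  simp only [Function.Embedding.trans_apply, RemS.dvE_apply, RemV.rvE_apply, RemO.roE_apply, DivS.ivE_apply, DivV.vvE_apply, DivO.voE_apply, InvS.pmE_apply, InvV.pvE_apply, InvS.lnE_apply] at r1 rDA rDB rT rT2 rQ rRB rG rpA rpB rpF rpG rpH rpC racc racc2 raccL rw' ro' rs' rd rn rpk rst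
  rw [show X1.sc ((RemS.dvE.trans ρ) (DivS.iv (InvS.pm PMulS.n))) = N from an] at r1
  rw [aaccR, hch1] at r1
  rw [an] at rn rpk
  have yv : ∀ w : RemV, (∀ i, w ≠ .rv i) → Y1.vi (ν w) = X1.vi (ν w) := fun w hw => rw' _ (fun i => by simpa using hw i)
  have yo : ∀ p : RemO, (∀ i, p ≠ .ro i) → Y1.vo (ω p) = X1.vo (ω p) := fun p hp => ro' _ (fun i => by simpa using hp i)
  have ys : ∀ r : RemS, (∀ i, r ≠ .dv i) → Y1.sc (ρ r) = X1.sc (ρ r) := fun r hr => rs' _ (fun i => by simpa using hr i)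
  have yREM : Y1.vi (ν .REM) = restR := (yv .REM (by simp)).trans aREM
  have yTREE : Y1.vi (ν .TREE) = treeBlock N vals j (2 * i + 1) ++ restT := (yv .TREE (by simp)).trans aTREE
  have yGIN : Y1.vi (ν .GIN) = σ.vi (ν .GIN) := (yv .GIN (by simp)).trans aGIN
  have yaccP : Y1.vo (ω .accP) = remBlock N g vals (j + 1) i := (yo .accP (by simp)).trans aaccP
  have yd : Y1.sc (ρ (.dv .d)) = 2 ^ j := rd
  have yn : Y1.sc (ρ (.dv (.iv (.pm .n)))) = N := rn
  have yDA : Y1.vi (ν (.rv .DA)) = [] := rDA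
  have yDB : Y1.vi (ν (.rv .DB)) = [] := rDB
  have yT : Y1.vi (ν (.rv .T)) = [] := rT
  have yT2 : Y1.vi (ν (.rv .T2)) = [] := rT2
  have yQ : Y1.vi (ν (.rv .Q)) = [] := rQ
  have yRB : Y1.vi (ν (.rv (.vv .RB))) = [] := rRB
  have yG : Y1.vi (ν (.rv (.vv .G))) = [] := rG
  have ypA : Y1.vi (ν (.rv (.vv (.pv .A)))) = [] := rpA
  have ypB : Y1.vi (ν (.rv (.vv (.pv .B)))) = [] := rpB
  have ypF : Y1.vi (ν (.rv (.vv (.pv .F)))) = [] := rpF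
  have ypG : Y1.vi (ν (.rv (.vv (.pv .G)))) = [] := rpG
  have ypH : Y1.vi (ν (.rv (.vv (.pv .H)))) = [] := rpH
  have ypC : Y1.vi (ν (.rv (.vv (.pv .C)))) = [] := rpC
  have yacc : Y1.vo (ω (.ro (.vo .acc))) = [] := racc
  have yacc2 : Y1.vo (ω (.ro (.vo .acc2))) = [] := racc2
  have yaccL : Y1.vo (ω (.ro (.vo .accL))) = [] := raccL
  have yaccR : Y1.vo (ω (.ro .accR)) = σ.vo (ω (.ro .accR)) ++ remBlock N g vals j (2 * i) := r1
  -- stage 2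
  have nX2 := hX2
  simp only [yd, yn, yDA, yDB, yT, yT2, yQ, yRB, yG, ypA, ypB, ypF, ypG, ypH, ypC, yacc, yacc2, yaccL, yaccR, yREM, yTREE, yGIN, yaccP, htakeR, hdropR, htakeT1, hdropT1, htakeT2, hdropT2, hdd, hd1l, hd1c, pairS1, pairS2, eval_seq, eval,
      NState.sc_bump, NState.sc_setSc, NState.sc_setVi, NState.sc_setVo, NState.vi_bump,
      NState.vi_setSc, NState.vi_setVi, NState.vi_setVo, NState.vo_bump, NState.vo_setSc, NState.vo_setVi, NState.vo_setVo,
      NState.steps_bump, NState.steps_setSc, NState.steps_setVi, NState.steps_setVo, NState.peak_bump, NState.peak_setSc, NState.peak_setVi,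
      NState.peak_setVo, Function.update_apply, EmbeddingLike.apply_eq_iff_eq, reduceCtorEq, RemV.rv.injEq, RemS.dv.injEq, RemO.ro.injEq,
      DivV.vv.injEq, DivS.iv.injEq, DivO.vo.injEq, InvV.pv.injEq, InvS.pm.injEq, InvS.ln.injEq,
      ite_true, ite_false, not_false_eq_true, implies_true, Nat.max_zero, Nat.zero_max, Nat.le_add_right,
      List.take_length, List.drop_length, List.nil_append, List.append_nil, le_refl, List.take_append_drop, List.length_nil, List.length_append,
      List.length_take, length_remBlock, length_treeBlock, teeN_eq 𝓔 _ hoP, moveN_eq' 𝓔] at nX2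
  obtain ⟨bREM, bTREE, bDA, bDB, bT, bT2, bQ, bRB, bG, bpA, bpB, bpF, bpG, bpH, bpC, bacc, bacc2, baccL, baccR, baccP, bd, bd1, bn, bGIN⟩ :
      X2.vi (ν .REM) = restR ∧
      X2.vi (ν .TREE) = restT ∧
      X2.vi (ν (.rv .DA)) = remBlock N g vals (j + 1) i ∧
      X2.vi (ν (.rv .DB)) = treeBlock N vals j (2 * i + 1) ∧
      X2.vi (ν (.rv .T)) = [] ∧
      X2.vi (ν (.rv .T2)) = [] ∧
      X2.vi (ν (.rv .Q)) = [] ∧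
      X2.vi (ν (.rv (.vv .RB))) = [] ∧
      X2.vi (ν (.rv (.vv .G))) = [] ∧
      X2.vi (ν (.rv (.vv (.pv .A)))) = [] ∧
      X2.vi (ν (.rv (.vv (.pv .B)))) = [] ∧
      X2.vi (ν (.rv (.vv (.pv .F)))) = [] ∧
      X2.vi (ν (.rv (.vv (.pv .G)))) = [] ∧
      X2.vi (ν (.rv (.vv (.pv .H)))) = [] ∧
      X2.vi (ν (.rv (.vv (.pv .C)))) = [] ∧
      X2.vo (ω (.ro (.vo .acc))) = [] ∧
      X2.vo (ω (.ro (.vo .acc2))) = [] ∧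
      X2.vo (ω (.ro (.vo .accL))) = [] ∧
      X2.vo (ω (.ro .accR)) = σ.vo (ω (.ro .accR)) ++ remBlock N g vals j (2 * i) ∧
      X2.vo (ω .accP) = [] ∧
      X2.sc (ρ (.dv .d)) = 2 ^ j ∧
      X2.sc (ρ (.dv .d1)) = 1 + 2 ^ j ∧
      X2.sc (ρ (.dv (.iv (.pm .n)))) = N ∧
      X2.vi (ν .GIN) = σ.vi (ν .GIN) := by
    rw [nX2]; simp only [yd, yn, yDA, yDB, yT, yT2, yQ, yRB, yG, ypA, ypB, ypF, ypG, ypH, ypC, yacc, yacc2, yaccL, yaccR, yREM, yTREE, yGIN, yaccP, htakeR, hdropR, htakeT1, hdropT1, htakeT2, hdropT2, hdd, hd1l, hd1c, NState.sc_bump, NState.sc_setSc, NState.sc_setVi, NState.sc_setVo, NState.vi_bump,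
      NState.vi_setSc, NState.vi_setVi, NState.vi_setVo, NState.vo_bump, NState.vo_setSc, NState.vo_setVi, NState.vo_setVo,
      NState.steps_bump, NState.steps_setSc, NState.steps_setVi, NState.steps_setVo, NState.peak_bump, NState.peak_setSc, NState.peak_setVi,
      NState.peak_setVo, Function.update_apply, EmbeddingLike.apply_eq_iff_eq, reduceCtorEq, RemV.rv.injEq, RemS.dv.injEq, RemO.ro.injEq,
      DivV.vv.injEq, DivS.iv.injEq, DivO.vo.injEq, InvV.pv.injEq, InvS.pm.injEq, InvS.ln.injEq,
      ite_true, ite_false, not_false_eq_true, implies_true, Nat.max_zero, Nat.zero_max, Nat.le_add_right,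
      List.take_length, List.drop_length, List.nil_append, List.append_nil, le_refl, List.take_append_drop, List.length_nil, List.length_append,
      List.length_take, length_remBlock, length_treeBlock, and_self, and_true, true_and]
  have bpk : X2.peak = max (max Y1.peak 1) (2 ^ j + 1) := by
    rw [nX2]; try simp only [yd, yn, yDA, yDB, yT, yT2, yQ, yRB, yG, ypA, ypB, ypF, ypG, ypH, ypC, yacc, yacc2, yaccL, yaccR, yREM, yTREE, yGIN, yaccP, htakeR, hdropR, htakeT1, hdropT1, htakeT2, hdropT2, hdd, hd1l, hd1c, NState.sc_bump, NState.sc_setSc, NState.sc_setVi, NState.sc_setVo, NState.vi_bump,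
      NState.vi_setSc, NState.vi_setVi, NState.vi_setVo, NState.vo_bump, NState.vo_setSc, NState.vo_setVi, NState.vo_setVo,
      NState.steps_bump, NState.steps_setSc, NState.steps_setVi, NState.steps_setVo, NState.peak_bump, NState.peak_setSc, NState.peak_setVi,
      NState.peak_setVo, Function.update_apply, EmbeddingLike.apply_eq_iff_eq, reduceCtorEq, RemV.rv.injEq, RemS.dv.injEq, RemO.ro.injEq,
      DivV.vv.injEq, DivS.iv.injEq, DivO.vo.injEq, InvV.pv.injEq, InvS.pm.injEq, InvS.ln.injEq,
      ite_true, ite_false, not_false_eq_true, implies_true, Nat.max_zero, Nat.zero_max, Nat.le_add_right,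
      List.take_length, List.drop_length, List.nil_append, List.append_nil, le_refl, List.take_append_drop, List.length_nil, List.length_append,
      List.length_take, length_remBlock, length_treeBlock]
  have bst : X2.steps ≤ Y1.steps + 7 * 2 ^ j + 10 := by
    rw [nX2]; simp only [yd, yn, yDA, yDB, yT, yT2, yQ, yRB, yG, ypA, ypB, ypF, ypG, ypH, ypC, yacc, yacc2, yaccL, yaccR, yREM, yTREE, yGIN, yaccP, htakeR, hdropR, htakeT1, hdropT1, htakeT2, hdropT2, hdd, hd1l, hd1c, NState.sc_bump, NState.sc_setSc, NState.sc_setVi, NState.sc_setVo, NState.vi_bump,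
      NState.vi_setSc, NState.vi_setVi, NState.vi_setVo, NState.vo_bump, NState.vo_setSc, NState.vo_setVi, NState.vo_setVo,
      NState.steps_bump, NState.steps_setSc, NState.steps_setVi, NState.steps_setVo, NState.peak_bump, NState.peak_setSc, NState.peak_setVi,
      NState.peak_setVo, Function.update_apply, EmbeddingLike.apply_eq_iff_eq, reduceCtorEq, RemV.rv.injEq, RemS.dv.injEq, RemO.ro.injEq,
      DivV.vv.injEq, DivS.iv.injEq, DivO.vo.injEq, InvV.pv.injEq, InvS.pm.injEq, InvS.ln.injEq,
      ite_true, ite_false, not_false_eq_true, implies_true, Nat.max_zero, Nat.zero_max, Nat.le_add_right,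
      List.take_length, List.drop_length, List.nil_append, List.append_nil, le_refl, List.take_append_drop, List.length_nil, List.length_append,
      List.length_take, length_remBlock, length_treeBlock]
    clear * - hpow; omega
  have b_r' : ∀ r : RemS, (∀ i, r ≠ .dv i) → X2.sc (ρ r) = Y1.sc (ρ r) := fun r hr => by rw [nX2]; simp only [hr, yd, yn, yDA, yDB, yT, yT2, yQ, yRB, yG, ypA, ypB, ypF, ypG, ypH, ypC, yacc, yacc2, yaccL, yaccR, yREM, yTREE, yGIN, yaccP, htakeR, hdropR, htakeT1, hdropT1, htakeT2, hdropT2, hdd, hd1l, hd1c, NState.sc_bump, NState.sc_setSc, NState.sc_setVi, NState.sc_setVo, NState.vi_bump,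
      NState.vi_setSc, NState.vi_setVi, NState.vi_setVo, NState.vo_bump, NState.vo_setSc, NState.vo_setVi, NState.vo_setVo,
      NState.steps_bump, NState.steps_setSc, NState.steps_setVi, NState.steps_setVo, NState.peak_bump, NState.peak_setSc, NState.peak_setVi,
      NState.peak_setVo, Function.update_apply, EmbeddingLike.apply_eq_iff_eq, reduceCtorEq, RemV.rv.injEq, RemS.dv.injEq, RemO.ro.injEq,
      DivV.vv.injEq, DivS.iv.injEq, DivO.vo.injEq, InvV.pv.injEq, InvS.pm.injEq, InvS.ln.injEq,
      ite_true, ite_false, not_false_eq_true, implies_true, Nat.max_zero, Nat.zero_max, Nat.le_add_right,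
      List.take_length, List.drop_length, List.nil_append, List.append_nil, le_refl, List.take_append_drop, List.length_nil, List.length_append,
      List.length_take, length_remBlock, length_treeBlock]
  have b_w : ∀ w, (∀ i, w ≠ ν i) → X2.vi w = σ.vi w := fun w hw => by
    rw [← a_w w hw, ← rw' w (fun i => hw (.rv i)), nX2]; simp only [hw, yd, yn, yDA, yDB, yT, yT2, yQ, yRB, yG, ypA, ypB, ypF, ypG, ypH, ypC, yacc, yacc2, yaccL, yaccR, yREM, yTREE, yGIN, yaccP, htakeR, hdropR, htakeT1, hdropT1, htakeT2, hdropT2, hdd, hd1l, hd1c, NState.sc_bump, NState.sc_setSc, NState.sc_setVi, NState.sc_setVo, NState.vi_bump,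
      NState.vi_setSc, NState.vi_setVi, NState.vi_setVo, NState.vo_bump, NState.vo_setSc, NState.vo_setVi, NState.vo_setVo,
      NState.steps_bump, NState.steps_setSc, NState.steps_setVi, NState.steps_setVo, NState.peak_bump, NState.peak_setSc, NState.peak_setVi,
      NState.peak_setVo, Function.update_apply, EmbeddingLike.apply_eq_iff_eq, reduceCtorEq, RemV.rv.injEq, RemS.dv.injEq, RemO.ro.injEq,
      DivV.vv.injEq, DivS.iv.injEq, DivO.vo.injEq, InvV.pv.injEq, InvS.pm.injEq, InvS.ln.injEq,
      ite_true, ite_false, not_false_eq_true, implies_true, Nat.max_zero, Nat.zero_max, Nat.le_add_right,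
      List.take_length, List.drop_length, List.nil_append, List.append_nil, le_refl, List.take_append_drop, List.length_nil, List.length_append,
      List.length_take, length_remBlock, length_treeBlock]
  have b_p : ∀ p, (∀ i, p ≠ ω i) → X2.vo p = σ.vo p := fun p hp => by
    rw [← a_p p hp, ← ro' p (fun i => hp (.ro i)), nX2]; simp only [hp, yd, yn, yDA, yDB, yT, yT2, yQ, yRB, yG, ypA, ypB, ypF, ypG, ypH, ypC, yacc, yacc2, yaccL, yaccR, yREM, yTREE, yGIN, yaccP, htakeR, hdropR, htakeT1, hdropT1, htakeT2, hdropT2, hdd, hd1l, hd1c, NState.sc_bump, NState.sc_setSc, NState.sc_setVi, NState.sc_setVo, NState.vi_bump,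
      NState.vi_setSc, NState.vi_setVi, NState.vi_setVo, NState.vo_bump, NState.vo_setSc, NState.vo_setVi, NState.vo_setVo,
      NState.steps_bump, NState.steps_setSc, NState.steps_setVi, NState.steps_setVo, NState.peak_bump, NState.peak_setSc, NState.peak_setVi,
      NState.peak_setVo, Function.update_apply, EmbeddingLike.apply_eq_iff_eq, reduceCtorEq, RemV.rv.injEq, RemS.dv.injEq, RemO.ro.injEq,
      DivV.vv.injEq, DivS.iv.injEq, DivO.vo.injEq, InvV.pv.injEq, InvS.pm.injEq, InvS.ln.injEq,
      ite_true, ite_false, not_false_eq_true, implies_true, Nat.max_zero, Nat.zero_max, Nat.le_add_right,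
      List.take_length, List.drop_length, List.nil_append, List.append_nil, le_refl, List.take_append_drop, List.length_nil, List.length_append,
      List.length_take, length_remBlock, length_treeBlock]
  have b_r : ∀ r, (∀ i, r ≠ ρ i) → X2.sc r = σ.sc r := fun r hr => by
    rw [← a_r r hr, ← rs' r (fun i => hr (.dv i)), nX2]; simp only [hr, yd, yn, yDA, yDB, yT, yT2, yQ, yRB, yG, ypA, ypB, ypF, ypG, ypH, ypC, yacc, yacc2, yaccL, yaccR, yREM, yTREE, yGIN, yaccP, htakeR, hdropR, htakeT1, hdropT1, htakeT2, hdropT2, hdd, hd1l, hd1c, NState.sc_bump, NState.sc_setSc, NState.sc_setVi, NState.sc_setVo, NState.vi_bump,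
      NState.vi_setSc, NState.vi_setVi, NState.vi_setVo, NState.vo_bump, NState.vo_setSc, NState.vo_setVi, NState.vo_setVo,
      NState.steps_bump, NState.steps_setSc, NState.steps_setVi, NState.steps_setVo, NState.peak_bump, NState.peak_setSc, NState.peak_setVi,
      NState.peak_setVo, Function.update_apply, EmbeddingLike.apply_eq_iff_eq, reduceCtorEq, RemV.rv.injEq, RemS.dv.injEq, RemO.ro.injEq,
      DivV.vv.injEq, DivS.iv.injEq, DivO.vo.injEq, InvV.pv.injEq, InvS.pm.injEq, InvS.ln.injEq,
      ite_true, ite_false, not_false_eq_true, implies_true, Nat.max_zero, Nat.zero_max, Nat.le_add_right,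
      List.take_length, List.drop_length, List.nil_append, List.append_nil, le_refl, List.take_append_drop, List.length_nil, List.length_append,
      List.length_take, length_remBlock, length_treeBlock]
  clear nX2
  -- the second division
  obtain ⟨q1, qDA, qDB, qT, qT2, qQ, qRB, qG, qpA, qpB, qpF, qpG, qpH, qpC, qacc, qacc2, qaccL, qw', qo', qs', qd, qn, qpk, qst, qext⟩ :=
    divP_spec M (RemS.dvE.trans ρ) (RemV.rvE.trans ν) (RemO.roE.trans ω) X2 (remBlock N g vals (j + 1) i) (treeBlock N vals j (2 * i + 1)) (2 ^ j) hpow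
      (by show 1 < X2.sc (ρ (.dv (.iv (.pm .n)))); rw [bn]; exact hN) (by show Odd (X2.sc (ρ (.dv (.iv (.pm .n))))); rw [bn]; exact hodd)
      bDA bDB hAl (length_treeBlock _ _ _)
      (by show ∀ x ∈ remBlock N g vals (j + 1) i, x < X2.sc (ρ (.dv (.iv (.pm .n)))); rw [bn]; exact hAN)
      (by show ∀ x ∈ treeBlock N vals j (2 * i + 1), x < X2.sc (ρ (.dv (.iv (.pm .n)))); rw [bn]; exact hB2N)
      hlast2 bd bT bT2 bQ bRB bG bpA bpB bpF bpG bpH bpC bacc bacc2 baccL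
  rw [← hτ] at q1 qDA qDB qT qT2 qQ qRB qG qpA qpB qpF qpG qpH qpC qacc qacc2 qaccL qw' qo' qs' qd qn qpk qst
  simp only [Function.Embedding.trans_apply, RemS.dvE_apply, RemV.rvE_apply, RemO.roE_apply, DivS.ivE_apply, DivV.vvE_apply, DivO.voE_apply, InvS.pmE_apply, InvV.pvE_apply, InvS.lnE_apply] at q1 qDA qDB qT qT2 qQ qRB qG qpA qpB qpF qpG qpH qpC qacc qacc2 qaccL qw' qo' qs' qd qn qpk qst
  rw [show X2.sc ((RemS.dvE.trans ρ) (DivS.iv (InvS.pm PMulS.n))) = N from bn] at q1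
  rw [baccR, hch2, List.append_assoc] at q1
  rw [bn] at qn qpk
  have tv : ∀ w : RemV, (∀ i, w ≠ .rv i) → τ.vi (ν w) = X2.vi (ν w) := fun w hw => qw' _ (fun i => by simpa using hw i)
  have to' : ∀ p : RemO, (∀ i, p ≠ .ro i) → τ.vo (ω p) = X2.vo (ω p) := fun p hp => qo' _ (fun i => by simpa using hp i)
  have ts : ∀ r : RemS, (∀ i, r ≠ .dv i) → τ.sc (ρ r) = X2.sc (ρ r) := fun r hr => qs' _ (fun i => by simpa using hr i)
  have hext : (pairR M ρ ν ω : NCom S V O E).extOK 𝓔 σ := by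
    show ((pairS1 ρ ν ω ;ₙ (divP M ρd νd ωd ;ₙ (pairS2 ρ ν ω ;ₙ divP M ρd νd ωd))) : NCom S V O E).extOK 𝓔 σ
    rw [extOK_seq, extOK_seq, extOK_seq, ← hX1, ← hY1, ← hX2]
    exact ⟨extOK_of_noExt 𝓔 (pairS_noExt ρ ν ω).1 σ, rext, extOK_of_noExt 𝓔 (pairS_noExt ρ ν ω).2 _, qext⟩
  refine ⟨⟨qn, qT, qT2, qQ, qRB, qG, qpA, qpB, qpF, qpG, qpH, qpC, qacc, qacc2, qaccL, (to' .accP (by simp)).trans baccP, qDA, qDB⟩,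
    q1, (tv .REM (by simp)).trans bREM, (tv .TREE (by simp)).trans bTREE, qd,
    fun w hw => (qw' w (fun i => hw (.rv i))).trans (b_w w hw), fun p hp => (qo' p (fun i => hp (.ro i))).trans (b_p p hp),
    fun r hr => (qs' r (fun i => hr (.dv i))).trans (b_r r hr),
    fun r hr => (ts r hr).trans ((b_r' r hr).trans ((ys r hr).trans (a_r' r hr))),
    (tv .GIN (by simp)).trans bGIN, ?_, ?_, hext⟩
  · -- peak
    have e1 := qpk; rw [bpk] at e1
    have e2 := rpk; rw [apk] at e2
    clear * - e1 e2 hpow hN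
    omega
  · -- steps
    have e1 := qst
    have e2 := bst
    have e3 := rst
    have e4 := ast
    simp only [divCost]
    clear * - e1 e2 e3 e4 hpow
    omega

omit [DecidableEq S] [DecidableEq V] [DecidableEq O] in
/-- `RemInv` only depends on the registers. [folklore] -/
theorem RemInv.bump {N : ℕ} {σ : NState S V O} (h : RemInv ρ ν ω N σ) (a k : ℕ) : RemInv ρ ν ω N (σ.bump a k) := by
  obtain ⟨h1, h2, h3, h4, h5, h6, h7, h8, h9, h10, h11, h12, h13, h14, h15, h16, h17, h18⟩ := h
  exact ⟨h1, h2, h3, h4, h5, h6, h7, h8, h9, h10, h11, h12, h13, h14, h15, h16, h17, h18⟩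

/-- **`t` pair steps of one level** (children level `j`, `c` parents). [folklore] -/
theorem pairR_iterate {N : ℕ} (hN : 1 < N) (hodd : Odd N) (g : (ZMod N)[X]) (vals : List ℕ) (j c : ℕ) (restT : List ℕ)
    (hvals : 2 * c * 2 ^ j ≤ vals.length) (σ : NState S V O) (hI : RemInv ρ ν ω N σ)
    (hREM : σ.vi (ν .REM) = remsFrom N g vals (j + 1) 0 c) (hTREE : σ.vi (ν .TREE) = blocksFrom N vals j 0 (2 * c) ++ restT)
    (hd : σ.sc (ρ (.dv .d)) = 2 ^ j) :
    ∀ t, t ≤ c → let τ := ((pairR M ρ ν ω : NCom S V O E).eval 𝓔)^[t] σ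
      RemInv ρ ν ω N τ ∧ τ.vi (ν .REM) = remsFrom N g vals (j + 1) t (c - t) ∧
        τ.vi (ν .TREE) = blocksFrom N vals j (2 * t) (2 * c - 2 * t) ++ restT ∧
        τ.vo (ω (.ro .accR)) = σ.vo (ω (.ro .accR)) ++ remsFrom N g vals j 0 (2 * t) ∧ τ.sc (ρ (.dv .d)) = 2 ^ j ∧
        (∀ w, (∀ i, w ≠ ν i) → τ.vi w = σ.vi w) ∧ (∀ p, (∀ i, p ≠ ω i) → τ.vo p = σ.vo p) ∧ (∀ r, (∀ i, r ≠ ρ i) → τ.sc r = σ.sc r) ∧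
        (∀ r : RemS, (∀ i, r ≠ .dv i) → τ.sc (ρ r) = σ.sc (ρ r)) ∧ τ.vi (ν .GIN) = σ.vi (ν .GIN) ∧
        τ.peak ≤ max σ.peak (max (3 * N) (8 * 2 ^ j + 2)) ∧
        τ.steps ≤ σ.steps + t * (2 * divCost M.cost (2 ^ j) + 30 * 2 ^ j + 30) ∧
        (t < c → (pairR M ρ ν ω : NCom S V O E).extOK 𝓔 τ)
  | 0, _ => by
    refine ⟨hI, by simpa using hREM, by simpa using hTREE, by simp, hd, fun _ _ => rfl, fun _ _ => rfl, fun _ _ => rfl, fun _ _ => rfl, rfl,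
      le_max_left _ _, by simp, fun h0 => ?_⟩
    obtain ⟨c', rfl⟩ : ∃ c', c = c' + 1 := ⟨c - 1, by omega⟩
    exact (pairR_spec M ρ ν ω hN hodd g vals j 0 (remsFrom N g vals (j + 1) 1 c') (blocksFrom N vals j 2 (2 * c') ++ restT) σ hI
      (by nlinarith) (by rw [hREM, remsFrom_succ])
      (by rw [hTREE, show 2 * (c' + 1) = 2 * c' + 1 + 1 by ring, blocksFrom_succ, blocksFrom_succ]; simp [List.append_assoc]) hd).2.2.2.2.2.2.2.2.2.2.2.2
  | t + 1, ht => by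
    obtain ⟨h1, h2, h3, h4, h5, h6, h7, h8, h9, h10, h11, h12, -⟩ := pairR_iterate hN hodd g vals j c restT hvals σ hI hREM hTREE hd t (Nat.le_of_succ_le ht)
    intro τ
    set υ := ((pairR M ρ ν ω : NCom S V O E).eval 𝓔)^[t] σ with hυ
    have hτ : τ = (pairR M ρ ν ω : NCom S V O E).eval 𝓔 υ := Function.iterate_succ_apply' _ _ _
    have eR : υ.vi (ν .REM) = remBlock N g vals (j + 1) t ++ remsFrom N g vals (j + 1) (t + 1) (c - t - 1) := by
      rw [h2, show c - t = (c - t - 1) + 1 by omega, remsFrom_succ, Nat.add_sub_cancel]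
    have eT : υ.vi (ν .TREE) = treeBlock N vals j (2 * t) ++ (treeBlock N vals j (2 * t + 1) ++ (blocksFrom N vals j (2 * t + 2) (2 * c - 2 * t - 2) ++ restT)) := by
      rw [h3, show 2 * c - 2 * t = (2 * c - 2 * t - 2) + 1 + 1 by omega, blocksFrom_succ, blocksFrom_succ]; simp [List.append_assoc]
    obtain ⟨r1, r2, r3, r4, r5, r6, r7, r8, r9, r10, r11, r12, -⟩ := pairR_spec M ρ ν ω hN hodd g vals j t _ _ υ h1 (by nlinarith) eR eT h5
    have hnext : t + 1 < c → (pairR M ρ ν ω : NCom S V O E).extOK 𝓔 τ := by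
      intro hlt
      rw [hτ]
      have eR' : ((pairR M ρ ν ω : NCom S V O E).eval 𝓔 υ).vi (ν .REM) = remBlock N g vals (j + 1) (t + 1) ++ remsFrom N g vals (j + 1) (t + 2) (c - t - 2) := by
        rw [r3, show c - t - 1 = (c - t - 2) + 1 by omega, remsFrom_succ]
      have eT' : ((pairR M ρ ν ω : NCom S V O E).eval 𝓔 υ).vi (ν .TREE) =
          treeBlock N vals j (2 * (t + 1)) ++ (treeBlock N vals j (2 * (t + 1) + 1) ++ (blocksFrom N vals j (2 * t + 4) (2 * c - 2 * t - 4) ++ restT)) := by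
        rw [r4, show 2 * c - 2 * t - 2 = (2 * c - 2 * t - 4) + 1 + 1 by omega, blocksFrom_succ, blocksFrom_succ]
        simp [List.append_assoc, show 2 * (t + 1) = 2 * t + 2 by ring, show 2 * t + 2 + 1 = 2 * t + 3 by ring]
      exact (pairR_spec M ρ ν ω hN hodd g vals j (t + 1) _ _ _ r1 (by nlinarith) eR' eT' r5).2.2.2.2.2.2.2.2.2.2.2.2
    rw [hτ]
    refine ⟨r1, ?_, ?_, ?_, r5, fun w hw => (r6 w hw).trans (h6 w hw), fun p hp => (r7 p hp).trans (h7 p hp), fun r hr => (r8 r hr).trans (h8 r hr),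
      fun r hr => (r9 r hr).trans (h9 r hr), r10.trans h10, r11.trans (max_le (h11.trans le_rfl) (le_max_right _ _)), ?_, hτ ▸ hnext⟩
    · rw [r3, show c - (t + 1) = c - t - 1 by omega]
    · rw [r4, show 2 * (t + 1) = 2 * t + 2 by ring, show 2 * c - (2 * t + 2) = 2 * c - 2 * t - 2 by omega]
    · rw [r2, h4, List.append_assoc, show 2 * (t + 1) = 2 * t + 1 + 1 by ring, remsFrom_concat, remsFrom_concat, List.append_assoc, Nat.zero_add,
        Nat.zero_add]
    · rw [Nat.succ_mul]; have := r12; omega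

/-- The work of the levels done so far: `Σ_{m'<m} (2^{m'} pairs at children level K-1-m' +
the level's bookkeeping)`. [folklore] -/
def remCostD (cost : ℕ → ℕ) (K : ℕ) : ℕ → ℕ
  | 0 => 0
  | m + 1 => remCostD cost K m + 2 ^ m * (2 * divCost cost (2 ^ (K - 1 - m)) + 30 * 2 ^ (K - 1 - m) + 30) + 2 ^ K + 2 ^ m + 4

/-- **One level of the remainder tree** (children level `j`, `c` parents, `cnt = c`,
`d = 2^j`, `two = 2`, `accR` empty): afterwards `REM` holds the `2c` children's remainders,
the level's tree blocks are consumed, `d := 2^j / 2`, `cnt := 2c`. [folklore] -/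
theorem levelR_spec {N : ℕ} (hN : 1 < N) (hodd : Odd N) (g : (ZMod N)[X]) (vals : List ℕ) (j c : ℕ) (restT : List ℕ)
    (hvals : 2 * c * 2 ^ j ≤ vals.length) (σ : NState S V O) (hI : RemInv ρ ν ω N σ)
    (hREM : σ.vi (ν .REM) = remsFrom N g vals (j + 1) 0 c) (hTREE : σ.vi (ν .TREE) = blocksFrom N vals j 0 (2 * c) ++ restT)
    (hd : σ.sc (ρ (.dv .d)) = 2 ^ j) (hcnt : σ.sc (ρ .cnt) = c) (htwo : σ.sc (ρ .two) = 2) (haccR : σ.vo (ω (.ro .accR)) = []) :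
    let τ := (levelR M ρ ν ω : NCom S V O E).eval 𝓔 σ
    RemInv ρ ν ω N τ ∧ τ.vi (ν .REM) = remsFrom N g vals j 0 (2 * c) ∧ τ.vi (ν .TREE) = restT ∧ τ.vo (ω (.ro .accR)) = [] ∧
      τ.sc (ρ (.dv .d)) = 2 ^ j / 2 ∧ τ.sc (ρ .cnt) = 2 * c ∧ τ.sc (ρ .two) = 2 ∧
      (∀ w, (∀ i, w ≠ ν i) → τ.vi w = σ.vi w) ∧ (∀ p, (∀ i, p ≠ ω i) → τ.vo p = σ.vo p) ∧ (∀ r, (∀ i, r ≠ ρ i) → τ.sc r = σ.sc r) ∧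
      τ.sc (ρ .K) = σ.sc (ρ .K) ∧ τ.sc (ρ .P) = σ.sc (ρ .P) ∧ τ.sc (ρ .top) = σ.sc (ρ .top) ∧ τ.vi (ν .GIN) = σ.vi (ν .GIN) ∧
      τ.peak ≤ max σ.peak (max (3 * N) (max (8 * 2 ^ j + 2) (2 * c))) ∧
      τ.steps ≤ σ.steps + c * (2 * divCost M.cost (2 ^ j) + 30 * 2 ^ j + 30) + 2 * c * 2 ^ j + c + 4 ∧
      (levelR M ρ ν ω : NCom S V O E).extOK 𝓔 σ := by
  intro τ
  have hiter := pairR_iterate M ρ ν ω hN hodd g vals j c restT hvals (σ.bump 0 (c + 1)) (hI.bump ρ ν ω 0 (c + 1)) hREM hTREE hd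
  obtain ⟨i1, i2, i3, i4, i5, i6, i7, i8, i9, i10, i11, i12, -⟩ := hiter c le_rfl
  set Y := ((pairR M ρ ν ω : NCom S V O E).eval 𝓔)^[c] (σ.bump 0 (c + 1)) with hY
  simp only [NState.sc_bump, NState.vi_bump, NState.vo_bump, NState.peak_bump, NState.steps_bump, Nat.max_zero, Nat.sub_self,
    remsFrom_zero, haccR, List.nil_append] at i2 i3 i4 i6 i7 i8 i9 i10 i11 i12
  have hτ : τ = ((pour (ω (.ro .accR)) (ν .REM) ;ₙ divmod (ρ (.dv .d)) (ρ .q2) (ρ (.dv .d)) (ρ .two) ;ₙ add (ρ .cnt) (ρ .cnt) (ρ .cnt) : NCom S V O E)).eval 𝓔 Y := by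
    show ((times (ρ .cnt) (pairR M ρ ν ω) ;ₙ _ : NCom S V O E)).eval 𝓔 σ = _
    rw [eval_seq, eval_times, hcnt]
  have ycnt : Y.sc (ρ .cnt) = c := (i9 .cnt (by simp)).trans hcnt
  have ytwo : Y.sc (ρ .two) = 2 := (i9 .two (by simp)).trans htwo
  have i3' : Y.vi (ν .TREE) = restT := by rw [i3]; simp
  obtain ⟨yn, yT, yT2, yQ, yRB, yG, ypA, ypB, ypF, ypG, ypH, ypC, yacc, yacc2, yaccL, yaccP, yDA, yDB⟩ := i1
  have hext : (levelR M ρ ν ω : NCom S V O E).extOK 𝓔 σ := by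
    refine ⟨?_, trivial, trivial, trivial⟩
    rw [extOK_times]
    intro t ht
    rw [hcnt] at ht ⊢
    exact (hiter t ht.le).2.2.2.2.2.2.2.2.2.2.2.2 ht
  refine ⟨⟨?_, ?_, ?_, ?_, ?_, ?_, ?_, ?_, ?_, ?_, ?_, ?_, ?_, ?_, ?_, ?_, ?_, ?_⟩, ?_, ?_, ?_, ?_, ?_, ?_, fun w hw => ?_, fun p hp => ?_, fun r hr => ?_,
    ?_, ?_, ?_, ?_, ?_, ?_, hext⟩
  · rw [hτ]; simpa [eval] using yn
  · rw [hτ]; simpa [eval] using yT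
  · rw [hτ]; simpa [eval] using yT2
  · rw [hτ]; simpa [eval] using yQ
  · rw [hτ]; simpa [eval] using yRB
  · rw [hτ]; simpa [eval] using yG
  · rw [hτ]; simpa [eval] using ypA
  · rw [hτ]; simpa [eval] using ypB
  · rw [hτ]; simpa [eval] using ypF
  · rw [hτ]; simpa [eval] using ypG
  · rw [hτ]; simpa [eval] using ypH
  · rw [hτ]; simpa [eval] using ypC
  · rw [hτ]; simpa [eval] using yacc
  · rw [hτ]; simpa [eval] using yacc2
  · rw [hτ]; simpa [eval] using yaccL
  · rw [hτ]; simpa [eval] using yaccP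
  · rw [hτ]; simpa [eval] using yDA
  · rw [hτ]; simpa [eval] using yDB
  · rw [hτ]; simp [eval, i2, i4]
  · rw [hτ]; simp [eval, i3']
  · rw [hτ]; simp [eval]
  · rw [hτ]; simp [eval, i5, ytwo]
  · rw [hτ]; simp [eval, ycnt]; ring
  · rw [hτ]; simp [eval, ytwo]
  · rw [hτ]; simp [eval, hw, i6 w hw]
  · rw [hτ]; simp [eval, hp, i7 p hp]
  · rw [hτ]; simp [eval, hr, i8 r hr]
  · rw [hτ]; simp [eval, i9 .K (by simp)]
  · rw [hτ]; simp [eval, i9 .P (by simp)]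
  · rw [hτ]; simp [eval, i9 .top (by simp)]
  · rw [hτ]; simp [eval, i10]
  · rw [hτ]
    simp only [eval, NState.peak_bump, NState.peak_setVi, NState.peak_setVo, NState.peak_setSc, NState.sc_bump, NState.sc_setSc, NState.sc_setVi,
      NState.sc_setVo, Function.update_apply, EmbeddingLike.apply_eq_iff_eq, reduceCtorEq, ite_false, Nat.max_zero, ycnt]
    clear * - i11
    omega
  · rw [hτ]
    simp only [eval, NState.steps_bump, NState.steps_setVi, NState.steps_setVo, NState.steps_setSc, i4, length_remsFrom]
    clear * - i12
    nlinarith [i12, Nat.zero_le (c * 2 ^ j)]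

/-- Halving the block length. [folklore] -/
theorem pow_div_succ_div_two (K m : ℕ) : 2 ^ K / 2 ^ (m + 1) / 2 = 2 ^ K / 2 ^ (m + 2) := by
  rw [Nat.div_div_eq_div_mul, ← pow_succ]

/-- The level-`0` remainders are the values (`c ≤ |vals|`, `1 < N`). [folklore] -/
theorem remsFrom_level_zero {N : ℕ} (hN : 1 < N) (g : (ZMod N)[X]) {vals : List ℕ} :
    ∀ {c : ℕ}, c ≤ vals.length → remsFrom N g vals 0 0 c = (List.range c).map fun i => (g.eval ((vals.getD i 0 : ℕ) : ZMod N)).val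
  | 0, _ => by simp
  | c + 1, hc => by
    rw [remsFrom_concat, remsFrom_level_zero hN g (Nat.le_of_succ_le hc), Nat.zero_add, remBlock_zero g (by omega), List.range_succ, List.map_append,
      List.map_singleton, List.getD_eq_getElem _ _ (show c < vals.length by omega)]

/-- Unfolding the stored tree at a successor. [folklore] -/
theorem treeAcc_eq_of_succ {N : ℕ} (vals : List ℕ) (K : ℕ) {e d : ℕ} (h : e = d + 1) :
    treeAcc N vals K e = blocksFrom N vals d 0 (2 ^ (K - d)) ++ treeAcc N vals K d := by subst h; rfl

/-- **The levels of the remainder tree** (`|vals| = 2^K`). [folklore] -/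
theorem levelR_iterate {N : ℕ} (hN : 1 < N) (hodd : Odd N) (g : (ZMod N)[X]) (vals : List ℕ) (K : ℕ) (hvals : vals.length = 2 ^ K)
    (σ : NState S V O) (hI : RemInv ρ ν ω N σ)
    (hREM : σ.vi (ν .REM) = remsFrom N g vals K 0 1) (hTREE : σ.vi (ν .TREE) = treeAcc N vals K K)
    (hd : σ.sc (ρ (.dv .d)) = 2 ^ K / 2) (hcnt : σ.sc (ρ .cnt) = 1) (htwo : σ.sc (ρ .two) = 2) (haccR : σ.vo (ω (.ro .accR)) = []) :
    ∀ m, m ≤ K → let τ := ((levelR M ρ ν ω : NCom S V O E).eval 𝓔)^[m] σ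
      RemInv ρ ν ω N τ ∧ τ.vi (ν .REM) = remsFrom N g vals (K - m) 0 (2 ^ m) ∧ τ.vi (ν .TREE) = treeAcc N vals K (K - m) ∧
        τ.vo (ω (.ro .accR)) = [] ∧ τ.sc (ρ (.dv .d)) = 2 ^ K / 2 ^ (m + 1) ∧ τ.sc (ρ .cnt) = 2 ^ m ∧ τ.sc (ρ .two) = 2 ∧
        (∀ w, (∀ i, w ≠ ν i) → τ.vi w = σ.vi w) ∧ (∀ p, (∀ i, p ≠ ω i) → τ.vo p = σ.vo p) ∧ (∀ r, (∀ i, r ≠ ρ i) → τ.sc r = σ.sc r) ∧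
        τ.sc (ρ .K) = σ.sc (ρ .K) ∧ τ.sc (ρ .P) = σ.sc (ρ .P) ∧ τ.sc (ρ .top) = σ.sc (ρ .top) ∧ τ.vi (ν .GIN) = σ.vi (ν .GIN) ∧
        τ.peak ≤ max σ.peak (max (3 * N) (4 * 2 ^ K + 2)) ∧
        τ.steps ≤ σ.steps + remCostD M.cost K m ∧
        (m < K → (levelR M ρ ν ω : NCom S V O E).extOK 𝓔 τ)
  | 0, _ => by
    refine ⟨hI, by simpa using hREM, by simpa using hTREE, haccR, by simpa using hd, by simpa using hcnt, htwo, fun _ _ => rfl, fun _ _ => rfl,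
      fun _ _ => rfl, rfl, rfl, rfl, rfl, le_max_left _ _, by simp [remCostD], fun h0 => ?_⟩
    have hK : K = (K - 1) + 1 := by omega
    have eT : σ.vi (ν .TREE) = blocksFrom N vals (K - 1) 0 (2 * 1) ++ treeAcc N vals K (K - 1) := by
      rw [hTREE, treeAcc_eq_of_succ vals K hK, show K - (K - 1) = 1 by omega, pow_one]
    have eR : σ.vi (ν .REM) = remsFrom N g vals (K - 1 + 1) 0 1 := by rw [hREM, ← hK]
    have hpK : 2 ^ K = 2 * 2 ^ (K - 1) := by rw [← pow_succ', Nat.sub_add_cancel (by omega : 1 ≤ K)]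
    have ed : σ.sc (ρ (.dv .d)) = 2 ^ (K - 1) := by rw [hd, hpK, Nat.mul_div_cancel_left _ (by norm_num)]
    have hv0 : 2 * 1 * 2 ^ (K - 1) ≤ vals.length := by rw [hvals, hpK, Nat.mul_one]
    exact (levelR_spec M ρ ν ω hN hodd g vals (K - 1) 1 _ hv0 σ hI eR eT ed hcnt htwo haccR).2.2.2.2.2.2.2.2.2.2.2.2.2.2.2.2
  | m + 1, hm => by
    obtain ⟨h1, h2, h3, h4, h5, h6, h7, h8, h9, h10, h11, h12, h13, h14, h15, h16, -⟩ := levelR_iterate hN hodd g vals K hvals σ hI hREM hTREE hd hcnt htwo haccR m (Nat.le_of_succ_le hm)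
    intro τ
    set υ := ((levelR M ρ ν ω : NCom S V O E).eval 𝓔)^[m] σ with hυ
    have hτ : τ = (levelR M ρ ν ω : NCom S V O E).eval 𝓔 υ := Function.iterate_succ_apply' _ _ _
    -- the level `j = K - 1 - m` with `c = 2^m` parents
    have hj : K - m = (K - 1 - m) + 1 := by omega
    have eT : υ.vi (ν .TREE) = blocksFrom N vals (K - 1 - m) 0 (2 * 2 ^ m) ++ treeAcc N vals K (K - 1 - m) := by
      rw [h3, treeAcc_eq_of_succ vals K hj, show K - (K - 1 - m) = m + 1 by omega, pow_succ, Nat.mul_comm]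
    have eR : υ.vi (ν .REM) = remsFrom N g vals (K - 1 - m + 1) 0 (2 ^ m) := by rw [h2, ← hj]
    have ed : υ.sc (ρ (.dv .d)) = 2 ^ (K - 1 - m) := by rw [h5, Nat.pow_div (by omega) (by norm_num)]; congr 1; omega
    have hv : 2 * 2 ^ m * 2 ^ (K - 1 - m) ≤ vals.length := by
      rw [hvals, show 2 * 2 ^ m = 2 ^ (m + 1) by rw [pow_succ]; ring, ← pow_add]; exact Nat.pow_le_pow_right (by norm_num) (by omega)
    obtain ⟨r1, r2, r3, r4, r5, r6, r7, r8, r9, r10, r11, r12, r13, r14, r15, r16, -⟩ :=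
      levelR_spec M ρ ν ω hN hodd g vals (K - 1 - m) (2 ^ m) _ hv υ h1 eR eT ed h6 h7 h4
    have hnext : m + 1 < K → (levelR M ρ ν ω : NCom S V O E).extOK 𝓔 τ := by
      intro hlt
      rw [hτ]
      have hj' : K - 1 - m = (K - 2 - m) + 1 := by omega
      have eT' : ((levelR M ρ ν ω : NCom S V O E).eval 𝓔 υ).vi (ν .TREE) = blocksFrom N vals (K - 2 - m) 0 (2 * 2 ^ (m + 1)) ++ treeAcc N vals K (K - 2 - m) := by
        rw [r3, treeAcc_eq_of_succ vals K hj', show K - (K - 2 - m) = m + 2 by omega, show (2 : ℕ) ^ (m + 2) = 2 * 2 ^ (m + 1) by rw [pow_succ]; ring]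
      have eR' : ((levelR M ρ ν ω : NCom S V O E).eval 𝓔 υ).vi (ν .REM) = remsFrom N g vals (K - 2 - m + 1) 0 (2 ^ (m + 1)) := by
        rw [r2, ← hj', pow_succ, Nat.mul_comm]
      have ed' : ((levelR M ρ ν ω : NCom S V O E).eval 𝓔 υ).sc (ρ (.dv .d)) = 2 ^ (K - 2 - m) := by
        rw [r5, hj', pow_succ, Nat.mul_div_cancel _ (by norm_num)]
      have hv' : 2 * 2 ^ (m + 1) * 2 ^ (K - 2 - m) ≤ vals.length := by
        rw [hvals, show 2 * 2 ^ (m + 1) = 2 ^ (m + 2) by rw [pow_succ]; ring, ← pow_add]; exact Nat.pow_le_pow_right (by norm_num) (by omega)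
      exact (levelR_spec M ρ ν ω hN hodd g vals (K - 2 - m) (2 ^ (m + 1)) _ hv' _ r1 eR' eT' ed' (by rw [r6, pow_succ, Nat.mul_comm]) r7 r4).2.2.2.2.2.2.2.2.2.2.2.2.2.2.2.2
    rw [hτ]
    refine ⟨r1, ?_, ?_, r4, ?_, ?_, r7, fun w hw => (r8 w hw).trans (h8 w hw), fun p hp => (r9 p hp).trans (h9 p hp), fun r hr => (r10 r hr).trans (h10 r hr),
      r11.trans h11, r12.trans h12, r13.trans h13, r14.trans h14, ?_, ?_, hτ ▸ hnext⟩
    · rw [r2, show K - (m + 1) = K - 1 - m by omega, pow_succ, Nat.mul_comm]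
    · rw [r3, show K - (m + 1) = K - 1 - m by omega]
    · rw [r5, ← ed, h5, pow_div_succ_div_two]
    · rw [r6, pow_succ, Nat.mul_comm]
    · have b1 : 8 * 2 ^ (K - 1 - m) + 2 ≤ 4 * 2 ^ K + 2 := by
        have : 2 * 2 ^ (K - 1 - m) ≤ 2 ^ K := by
          rw [← pow_succ', show K - 1 - m + 1 = K - m by omega]; exact Nat.pow_le_pow_right (by norm_num) (by omega)
        omega
      have b2 : 2 * 2 ^ m ≤ 4 * 2 ^ K + 2 := by
        have : 2 ^ m ≤ 2 ^ K := Nat.pow_le_pow_right (by norm_num) (by omega)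
        omega
      clear * - r15 h15 b1 b2
      omega
    · rw [remCostD]
      have e := r16
      have hpk : 2 * 2 ^ m * 2 ^ (K - 1 - m) = 2 ^ K := by
        rw [show 2 * 2 ^ m = 2 ^ (m + 1) by rw [pow_succ]; ring, ← pow_add]; congr 1; omega
      rw [hpk] at e
      clear * - e h16
      omega

omit [DecidableEq S] [DecidableEq V] [DecidableEq O] in
/-- `remInit`'s straight-line parts have no extension calls. [folklore] -/
theorem remInit_noExt : (remInit ρ ν ω : NCom S V O E).noExt := by
  simp [remInit, noExt, linP_noExt]

set_option maxHeartbeats 4000000 in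
/-- **The root step and initialisation.** [folklore] -/
theorem remInit_facts {N : ℕ} (hN : 1 < N) (GIN vals : List ℕ) (K : ℕ) (σ : NState S V O) (hI : RemInv ρ ν ω N σ)
    (hK : σ.sc (ρ .K) = K) (hP : σ.sc (ρ .P) = 2 ^ K) (htop : σ.sc (ρ .top) = GIN.getD (2 ^ K) 0) (htop1 : σ.sc (ρ .top) ≤ 1)
    (hGIN : σ.vi (ν .GIN) = GIN) (hGl : GIN.length = 2 ^ K + 1) (hGN : ∀ x ∈ GIN, x < N)
    (hTREE : σ.vi (ν .TREE) = treeAcc N vals K (K + 1)) (hvals : vals.length = 2 ^ K) (hREM : σ.vi (ν .REM) = []) (haccR : σ.vo (ω (.ro .accR)) = []) :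
    let τ := (remInit ρ ν ω : NCom S V O E).eval 𝓔 σ
    RemInv ρ ν ω N τ ∧ τ.vi (ν .REM) = remsFrom N (listPoly N GIN) vals K 0 1 ∧ τ.vi (ν .TREE) = treeAcc N vals K K ∧
      τ.vo (ω (.ro .accR)) = [] ∧ τ.sc (ρ (.dv .d)) = 2 ^ K / 2 ∧ τ.sc (ρ .cnt) = 1 ∧ τ.sc (ρ .two) = 2 ∧ τ.sc (ρ .K) = K ∧ τ.vi (ν .GIN) = [] ∧
      (∀ w, (∀ i, w ≠ ν i) → τ.vi w = σ.vi w) ∧ (∀ p, (∀ i, p ≠ ω i) → τ.vo p = σ.vo p) ∧ (∀ r, (∀ i, r ≠ ρ i) → τ.sc r = σ.sc r) ∧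
      τ.peak ≤ max σ.peak (max (2 * N) 2) ∧ τ.steps = σ.steps + 10 * 2 ^ K + 13 := by
  intro τ
  obtain ⟨hn, hT, hT2, hQ, hRB, hG, hpA, hpB, hpF, hpG, hpH, hpC, hacc, hacc2, haccL, haccP, hDA, hDB⟩ := hI
  have huv : ν .GIN ≠ ν .TREE := by simp
  have hTR : treeAcc N vals K (K + 1) = treeBlock N vals K 0 ++ treeAcc N vals K K := by
    rw [treeAcc, Nat.sub_self, pow_zero, show blocksFrom N vals K 0 1 = treeBlock N vals K 0 ++ [] from blocksFrom_succ vals K 0 0, List.append_nil]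
  have hrl : (treeBlock N vals K 0).length = 2 ^ K + 1 := length_treeBlock _ _ _
  obtain ⟨a, ha⟩ : ∃ a, (treeBlock N vals K 0).drop (2 ^ K) = [a] := by
    have hl : ((treeBlock N vals K 0).drop (2 ^ K)).length = 1 := by rw [List.length_drop, hrl]; omega
    match h : (treeBlock N vals K 0).drop (2 ^ K), hl with
    | [x], _ => exact ⟨x, rfl⟩
  obtain ⟨b, hb⟩ : ∃ b, GIN.drop (2 ^ K) = [b] := by
    have hl : (GIN.drop (2 ^ K)).length = 1 := by rw [List.length_drop, hGl]; omega
    match h : GIN.drop (2 ^ K), hl with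
    | [x], _ => exact ⟨x, rfl⟩
  -- stage A: constants
  set XA := ((mov (ρ (.dv (.iv (.ln .cnt)))) (ρ .P) : NCom S V O E)).eval 𝓔 (((mov (ρ (.dv (.iv (.ln .n)))) (ρ (.dv (.iv (.pm .n)))) : NCom S V O E)).eval 𝓔
    (((mov (ρ (.dv (.iv (.ln .cv)))) (ρ .top) : NCom S V O E)).eval 𝓔 (((setc (ρ (.dv (.iv (.ln .cu)))) 1 : NCom S V O E)).eval 𝓔
    (((setc (ρ (.dv (.iv .one))) 1 : NCom S V O E)).eval 𝓔 (((setc (ρ .two) 2 : NCom S V O E)).eval 𝓔 σ))))) with hXA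
  have hτ : τ = ((pop (ν .TREE) (ρ (.dv (.iv (.pm .x)))) ;ₙ clearV (ν .GIN) ;ₙ pour (ω (.ro .accR)) (ν .REM) ;ₙ
      divmod (ρ (.dv .d)) (ρ .q2) (ρ .P) (ρ .two) ;ₙ setc (ρ .cnt) 1 : NCom S V O E)).eval 𝓔
      ((linP ρl (ν .GIN) (ν .TREE) (ω (.ro .accR)) : NCom S V O E).eval 𝓔 XA) := by
    show ((remInit ρ ν ω : NCom S V O E)).eval 𝓔 σ = _
    simp only [remInit, eval_seq, hXA]
  -- the root combination
  obtain ⟨l1, l2, l3, l4, l5, l6, l7, l8, l9⟩ := linP_spec 𝓔 (InvS.lnE.trans (DivS.ivE.trans (RemS.dvE.trans ρ))) (ν .GIN) (ν .TREE) (ω (.ro .accR)) huv XA (U := N)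
    (by show ∀ a ∈ XA.vi (ν .GIN), a ≤ N; simp only [hXA, eval, NState.vi_bump, NState.vi_setSc, hGIN]; exact fun a ha => (hGN a ha).le)
    (by show XA.sc (ρ (.dv (.iv (.ln .cnt)))) ≤ (XA.vi (ν .TREE)).length; simp [hXA, eval, hP, hTREE, hTR, hrl]; omega)
  simp only [Function.Embedding.trans_apply, RemS.dvE_apply, DivS.ivE_apply, InvS.lnE_apply] at l1 l2 l3 l4 l5 l6 l7 l8 l9
  have xGIN : XA.vi (ν .GIN) = GIN := by simp [hXA, eval, hGIN]
  have xTREE : XA.vi (ν .TREE) = treeBlock N vals K 0 ++ treeAcc N vals K K := by simp [hXA, eval, hTREE, hTR]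
  have xcnt : XA.sc (ρ (.dv (.iv (.ln .cnt)))) = 2 ^ K := by simp [hXA, eval, hP]
  have xcu : XA.sc (ρ (.dv (.iv (.ln .cu)))) = 1 := by simp [hXA, eval]
  have xcv : XA.sc (ρ (.dv (.iv (.ln .cv)))) = GIN.getD (2 ^ K) 0 := by simp [hXA, eval, htop]
  have xln : XA.sc (ρ (.dv (.iv (.ln .n)))) = N := by simp [hXA, eval, hn]
  have xaccR : XA.vo (ω (.ro .accR)) = [] := by simp [hXA, eval, haccR]
  rw [xGIN, xcnt, hb] at l1
  rw [xTREE, xcnt, List.drop_append_of_le_length (by rw [hrl]; omega), ha, List.singleton_append] at l2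
  rw [xaccR, xln, xcu, xcv, xGIN, xTREE, xcnt, List.nil_append, linc_take, List.take_append_of_le_length (by rw [hrl]; omega), ← linc_take,
    remBlock_root hN hGl hvals] at l3
  rw [xcu, xcv, xln] at l8
  rw [xcnt] at l9
  have xpk : XA.peak = max (max (max (max (max (max σ.peak 2) 1) 1) 0) 0) 0 := by simp [hXA, eval]
  have xst : XA.steps = σ.steps + 6 := by simp [hXA, eval]
  -- reading the final state
  set L := (linP ρl (ν .GIN) (ν .TREE) (ω (.ro .accR)) : NCom S V O E).eval 𝓔 XA with hL
  clear_value L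
  have lx : ∀ r : RemS, (∀ i, r ≠ .dv (.iv (.ln i))) → L.sc (ρ r) = XA.sc (ρ r) := fun r hr => l5 _ (fun i => by simpa using hr i)
  refine ⟨⟨?_, ?_, ?_, ?_, ?_, ?_, ?_, ?_, ?_, ?_, ?_, ?_, ?_, ?_, ?_, ?_, ?_, ?_⟩, ?_, ?_, ?_, ?_, ?_, ?_, ?_, ?_, fun w hw => ?_, fun p hp => ?_, fun r hr => ?_, ?_, ?_⟩
  · rw [hτ]; simp [eval, lx (.dv (.iv (.pm .n))) (by simp), hXA, hn]
  · rw [hτ]; simp [eval, l6 _ (show ν (.rv .T) ≠ ν .GIN by simp) (show ν (.rv .T) ≠ ν .TREE by simp), hXA, hT]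
  · rw [hτ]; simp [eval, l6 _ (show ν (.rv .T2) ≠ ν .GIN by simp) (show ν (.rv .T2) ≠ ν .TREE by simp), hXA, hT2]
  · rw [hτ]; simp [eval, l6 _ (show ν (.rv .Q) ≠ ν .GIN by simp) (show ν (.rv .Q) ≠ ν .TREE by simp), hXA, hQ]
  · rw [hτ]; simp [eval, l6 _ (show ν (.rv (.vv .RB)) ≠ ν .GIN by simp) (show ν (.rv (.vv .RB)) ≠ ν .TREE by simp), hXA, hRB]
  · rw [hτ]; simp [eval, l6 _ (show ν (.rv (.vv .G)) ≠ ν .GIN by simp) (show ν (.rv (.vv .G)) ≠ ν .TREE by simp), hXA, hG]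
  · rw [hτ]; simp [eval, l6 _ (show ν (.rv (.vv (.pv .A))) ≠ ν .GIN by simp) (show ν (.rv (.vv (.pv .A))) ≠ ν .TREE by simp), hXA, hpA]
  · rw [hτ]; simp [eval, l6 _ (show ν (.rv (.vv (.pv .B))) ≠ ν .GIN by simp) (show ν (.rv (.vv (.pv .B))) ≠ ν .TREE by simp), hXA, hpB]
  · rw [hτ]; simp [eval, l6 _ (show ν (.rv (.vv (.pv .F))) ≠ ν .GIN by simp) (show ν (.rv (.vv (.pv .F))) ≠ ν .TREE by simp), hXA, hpF]
  · rw [hτ]; simp [eval, l6 _ (show ν (.rv (.vv (.pv .G))) ≠ ν .GIN by simp) (show ν (.rv (.vv (.pv .G))) ≠ ν .TREE by simp), hXA, hpG]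
  · rw [hτ]; simp [eval, l6 _ (show ν (.rv (.vv (.pv .H))) ≠ ν .GIN by simp) (show ν (.rv (.vv (.pv .H))) ≠ ν .TREE by simp), hXA, hpH]
  · rw [hτ]; simp [eval, l6 _ (show ν (.rv (.vv (.pv .C))) ≠ ν .GIN by simp) (show ν (.rv (.vv (.pv .C))) ≠ ν .TREE by simp), hXA, hpC]
  · rw [hτ]; simp [eval, l7 _ (show ω (.ro (.vo .acc)) ≠ ω (.ro .accR) by simp), hXA, hacc]
  · rw [hτ]; simp [eval, l7 _ (show ω (.ro (.vo .acc2)) ≠ ω (.ro .accR) by simp), hXA, hacc2]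
  · rw [hτ]; simp [eval, l7 _ (show ω (.ro (.vo .accL)) ≠ ω (.ro .accR) by simp), hXA, haccL]
  · rw [hτ]; simp [eval, l7 _ (show ω .accP ≠ ω (.ro .accR) by simp), hXA, haccP]
  · rw [hτ]; simp [eval, l6 _ (show ν (.rv .DA) ≠ ν .GIN by simp) (show ν (.rv .DA) ≠ ν .TREE by simp), hXA, hDA]
  · rw [hτ]; simp [eval, l6 _ (show ν (.rv .DB) ≠ ν .GIN by simp) (show ν (.rv .DB) ≠ ν .TREE by simp), hXA, hDB]
  · rw [hτ]; simp [eval, l3, l6 _ (show ν .REM ≠ ν .GIN by simp) (show ν .REM ≠ ν .TREE by simp), hXA, hREM, remsFrom_succ]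
  · rw [hτ]; simp [eval, l2]
  · rw [hτ]; simp [eval]
  · rw [hτ]; simp [eval, lx .P (by simp), lx .two (by simp), hXA, hP]
  · rw [hτ]; simp [eval]
  · rw [hτ]; simp [eval, lx .two (by simp), hXA]
  · rw [hτ]; simp [eval, lx .K (by simp), hXA, hK]
  · rw [hτ]; simp [eval]
  · rw [hτ]; simp [eval, hw, l6 _ (hw .GIN) (hw .TREE), hXA]
  · rw [hτ]; simp [eval, hp, l7 _ (hp (.ro .accR)), hXA]
  · rw [hτ]; simp [eval, hr, l5 _ (fun i => hr (.dv (.iv (.ln i)))), hXA]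
  · rw [hτ]
    simp only [eval, NState.peak_bump, NState.peak_setSc, NState.peak_setVi, NState.peak_setVo, Nat.max_zero]
    rw [xpk] at l8
    have htopN : GIN.getD (2 ^ K) 0 * N ≤ N := by rw [← htop]; calc σ.sc (ρ .top) * N ≤ 1 * N := Nat.mul_le_mul_right _ htop1
      _ = N := Nat.one_mul _
    clear * - l8 htopN hN
    omega
  · rw [hτ]
    simp only [eval, NState.steps_bump, NState.steps_setSc, NState.steps_setVi, NState.steps_setVo, NState.vi_bump, NState.vi_setSc, NState.vi_setVi,
      NState.vo_bump, NState.vo_setSc, NState.vo_setVi, l9, xst, l3, length_remBlock]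
    rw [Function.update_of_ne (show ν .GIN ≠ ν .TREE by simp), l1, List.length_singleton]
    ring

/-- **Specification of the remainder tree** (von zur Gathen–Gerhard 2013, Algorithm 10.5 /
Theorem 10.6; Harvey 2021, §2.3).  From the stored subproduct tree of `vals` (`|vals| = 2^K`,
root first, as left by `ptreeP`) in `TREE` and a coefficient list `GIN` of length `2^K + 1`
(reduced entries, `top` = its last entry, at most `1`) in `GIN`: afterwards
`REM = [g(v_0), …, g(v_{2^K - 1})]` for `g = listPoly N GIN`, `TREE`, `GIN` and all work queues
are empty; `peak ≤ max peak (max 3N (4 · 2^K + 2))`;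
`steps ≤ steps + 10 · 2^K + remCostD cost K K + K + 14`. [folklore] -/
theorem remtreeP_spec {N : ℕ} (hN : 1 < N) (hodd : Odd N) (GIN vals : List ℕ) (K : ℕ) (σ : NState S V O) (hI : RemInv ρ ν ω N σ)
    (hK : σ.sc (ρ .K) = K) (hP : σ.sc (ρ .P) = 2 ^ K) (htop : σ.sc (ρ .top) = GIN.getD (2 ^ K) 0) (htop1 : σ.sc (ρ .top) ≤ 1)
    (hGIN : σ.vi (ν .GIN) = GIN) (hGl : GIN.length = 2 ^ K + 1) (hGN : ∀ x ∈ GIN, x < N)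
    (hTREE : σ.vi (ν .TREE) = treeAcc N vals K (K + 1)) (hvals : vals.length = 2 ^ K) (hREM : σ.vi (ν .REM) = []) (haccR : σ.vo (ω (.ro .accR)) = []) :
    let τ := (remtreeP M ρ ν ω : NCom S V O E).eval 𝓔 σ
    RemInv ρ ν ω N τ ∧
      τ.vi (ν .REM) = (List.range (2 ^ K)).map (fun i => ((listPoly N GIN).eval ((vals.getD i 0 : ℕ) : ZMod N)).val) ∧
      τ.vi (ν .TREE) = [] ∧ τ.vi (ν .GIN) = [] ∧ τ.vo (ω (.ro .accR)) = [] ∧ τ.sc (ρ .K) = K ∧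
      (∀ w, (∀ i, w ≠ ν i) → τ.vi w = σ.vi w) ∧ (∀ p, (∀ i, p ≠ ω i) → τ.vo p = σ.vo p) ∧ (∀ r, (∀ i, r ≠ ρ i) → τ.sc r = σ.sc r) ∧
      τ.peak ≤ max σ.peak (max (3 * N) (4 * 2 ^ K + 2)) ∧
      τ.steps ≤ σ.steps + 10 * 2 ^ K + remCostD M.cost K K + K + 14 ∧
      (remtreeP M ρ ν ω : NCom S V O E).extOK 𝓔 σ := by
  intro τ
  obtain ⟨x1, x2, x3, x4, x5, x6, x7, x8, x9, x10, x11, x12, x13, x14⟩ :=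
    remInit_facts ρ ν ω (𝓔 := 𝓔) hN GIN vals K σ hI hK hP htop htop1 hGIN hGl hGN hTREE hvals hREM haccR
  set X := (remInit ρ ν ω : NCom S V O E).eval 𝓔 σ with hX
  have hτ : τ = ((levelR M ρ ν ω : NCom S V O E).eval 𝓔)^[K] (X.bump 0 (K + 1)) := by
    show ((remInit ρ ν ω ;ₙ times (ρ .K) (levelR M ρ ν ω) : NCom S V O E)).eval 𝓔 σ = _
    rw [eval_seq, eval_times, ← hX, x8]
  clear_value X τ
  have hiter := levelR_iterate M ρ ν ω hN hodd (listPoly N GIN) vals K hvals (X.bump 0 (K + 1)) (x1.bump ρ ν ω 0 (K + 1)) x2 x3 x5 x6 x7 x4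
  obtain ⟨y1, y2, y3, y4, y5, y6, y7, y8, y9, y10, y11, y12, y13, y14, y15, y16, -⟩ := hiter K le_rfl
  rw [← hτ] at y1 y2 y3 y4 y5 y6 y7 y8 y9 y10 y11 y12 y13 y14 y15 y16
  simp only [NState.sc_bump, NState.vi_bump, NState.vo_bump, NState.peak_bump, NState.steps_bump, Nat.max_zero, Nat.sub_self] at y2 y3 y8 y9 y10 y11 y12 y13 y14 y15 y16
  refine ⟨y1, ?_, ?_, y14.trans x9, y4, y11.trans x8, fun w hw => (y8 w hw).trans (x10 w hw), fun p hp => (y9 p hp).trans (x11 p hp),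
    fun r hr => (y10 r hr).trans (x12 r hr), ?_, ?_, ?_⟩
  · rw [y2, remsFrom_level_zero hN _ (by rw [hvals])]
  · rw [y3]; rfl
  · refine y15.trans (max_le (x13.trans (max_le (le_max_left _ _) (le_max_of_le_right ?_))) (le_max_right _ _))
    have := Nat.one_le_two_pow (n := K)
    exact max_le (le_max_of_le_left (by omega)) (le_max_of_le_right (by omega))
  · rw [x14] at y16; omega
  · refine ⟨extOK_of_noExt 𝓔 (remInit_noExt ρ ν ω) σ, ?_⟩
    rw [extOK_times, ← hX, x8]
    intro m hm
    exact (hiter m hm.le).2.2.2.2.2.2.2.2.2.2.2.2.2.2.2.2 hm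

end Rem

end NCom

end Literature.Computability.Complexity
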